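import Summits.ValiantsHypothesis.ValiantsHypothesis.Theses.ContractivityPrice
import Summits.ValiantsHypothesis.ValiantsHypothesis.Theorems.PrincipalMinorColouringNormalForm
import Summits.ValiantsHypothesis.ValiantsHypothesis.Theorems.ContractivityPricePriceOfContractivityStubSameSizeUpperTriangular
import Summits.ValiantsHypothesis.ValiantsHypothesis.Theorems.ContractivityPricePriceOfContractivityStubSameSizeSingleColour
import Summits.ValiantsHypothesis.ValiantsHypothesis.Theorems.ContractivityPricePriceOfContractivityStubSameSizeRankOne
import Summits.ValiantsHypothesis.ValiantsHypothesis.Theorems.ContractivityPricePriceOfContractivityStubSameSizeNormal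
import Summits.ValiantsHypothesis.ValiantsHypothesis.Theorems.ContractivityPricePriceOfContractivityStubSameSizeMonochromeBlocks
import Summits.ValiantsHypothesis.ValiantsHypothesis.Theorems.ContractivityPricePriceOfContractivityStubArcStep
import Summits.ValiantsHypothesis.ValiantsHypothesis.Theorems.ContractivityPricePriceOfContractivityStubPermCounts
import Summits.ValiantsHypothesis.ValiantsHypothesis.Theorems.ContractivityPricePriceOfContractivityStubArcInduction
import Summits.ValiantsHypothesis.ValiantsHypothesis.Theorems.ContractivityPricePriceOfContractivityStubCycleBalancing
import Summits.ValiantsHypothesis.ValiantsHypothesis.Theorems.ContractivityPricePriceOfContractivityStubCycleBound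
import Summits.ValiantsHypothesis.ValiantsHypothesis.Theorems.ContractivityPricePriceOfContractivityStubBalancedBudgetInjective
import Summits.ValiantsHypothesis.ValiantsHypothesis.Theorems.ContractivityPricePriceOfContractivityStubStableLiftingTwoColour
import Summits.ValiantsHypothesis.ValiantsHypothesis.Theorems.ContractivityPricePriceOfContractivityStubTwoVar
import Summits.ValiantsHypothesis.ValiantsHypothesis.Theorems.ContractivityPricePriceOfContractivityStubOneLargeClass
import Summits.ValiantsHypothesis.ValiantsHypothesis.Theorems.ContractivityPricePriceOfContractivityStubNormHalvingInjectiveBudget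
import Summits.ValiantsHypothesis.ValiantsHypothesis.Theorems.ContractivityPricePriceOfContractivityStubNormHalvingRescale
import Summits.ValiantsHypothesis.ValiantsHypothesis.Theorems.ContractivityPricePriceOfContractivityStubNormHalvingOneTwoColour
import Summits.ValiantsHypothesis.ValiantsHypothesis.Theorems.ContractivityPricePriceOfContractivityStubMinorBoundDirectSum
import Summits.ValiantsHypothesis.ValiantsHypothesis.Theorems.ContractivityPricePriceOfContractivityStubPencilBlockTriangular
import Summits.ValiantsHypothesis.ValiantsHypothesis.Theorems.ContractivityPricePriceOfContractivityStubFewColoursSchur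
import Summits.ValiantsHypothesis.ValiantsHypothesis.Theorems.ContractivityPricePriceOfContractivityStubFewColoursCoeffBound
import Summits.ValiantsHypothesis.ValiantsHypothesis.Theorems.ContractivityPricePriceOfContractivityStubFewColoursTrie
import Summits.ValiantsHypothesis.ValiantsHypothesis.Theorems.ContractivityPricePriceOfContractivityStubFewColoursAssembly
import Summits.ValiantsHypothesis.ValiantsHypothesis.Theorems.ContractivityPricePriceOfContractivityStubFewColoursContent
import Summits.ValiantsHypothesis.ValiantsHypothesis.Theorems.ContractivityPricePriceOfContractivityStubFewColours
import Summits.ValiantsHypothesis.ValiantsHypothesis.Theorems.ContractivityPricePriceOfContractivityStubFewVars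
import Summits.ValiantsHypothesis.ValiantsHypothesis.Theorems.ContractivityPricePriceOfContractivityStubFewVarsBudget
import Summits.ValiantsHypothesis.ValiantsHypothesis.Theorems.ContractivityPricePriceOfContractivityStubNCauchyCoeff
import Summits.ValiantsHypothesis.ValiantsHypothesis.Theorems.ContractivityPricePriceOfContractivityStubNGramStein
import Summits.ValiantsHypothesis.ValiantsHypothesis.Theorems.ContractivityPricePriceOfContractivityStubNContraction
import Summits.ValiantsHypothesis.ValiantsHypothesis.Theorems.ContractivityPricePriceOfContractivityStubNAssembly
import Summits.ValiantsHypothesis.ValiantsHypothesis.Theorems.ContractivityPricePriceOfContractivityStubNormHalvingOneClassOneSingleton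
import Literature.LinearAlgebra.Matrix.MvPolynomialDetDegree

/-!
# Crux `PriceOfContractivity` (stmt-ValiantsHypothesis-10583) — line `birth` ("budget, then halving"),
lead's reshaped skeleton (rev 18, 2026-08-17, lead c4)

Rev 18 (lead c4): ALL FIVE rev-17 registrations have LANDED — `stubN_cauchyCoeff` (p173280, `…StubNCauchyCoeff.lean`),
`stubN_gramStein` (p173356, `…StubNGramStein.lean`), `stubN_contraction` (p173537, `…StubNContraction.lean`), `stubN_assembly`
(p173545, `…StubNAssembly.lean`) and the registered partial case `stub_normHalvingOne_oneClassOneSingleton` (p174075,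
`…StubNormHalvingOneClassOneSingleton.lean`): NH₁ for one colour class + one further row is an UNCONDITIONAL tree theorem.
`sorry` occurs only in the two composing stubs ♦ (`stub_stableLifting`) and NH₁ (`stub_normHalvingOne`); 37 tree files support the item.

Rev 17 (lead c4): §2a⁗ registers the first UNCONDITIONAL case of NH₁ with a genuine two-variable interaction —
`stub_normHalvingOne_oneClassOneSingleton` (one colour class + at most one further row; Doyle's `2S+F ≤ 3` regime
`S = F = 1`), by the WEIGHTED MODEL-SPACE COLLIGATION (Stein identity `‖g‖² = |g(0)|² + 2‖Sg‖²` for the norm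
`Σ|ĝ(k)|²2^k`, Cauchy's estimate, `[[−TST⁻¹, √2 T Sφ],[−ev₀T⁻¹/√2, φ(0)]]` is a contraction with `x`-block
characteristic polynomial EXACTLY `a`), in four provable pieces `stubN_cauchyCoeff`, `stubN_gramStein`,
`stubN_contraction`, `stubN_assembly`.  The composing stubs are unchanged: `sorry` in ♦ (`stub_stableLifting`),
NH₁ (`stub_normHalvingOne`) and, until they land, in the five rev-17 registrations.

Rev 16 (lead c3): `stub_budgetOfContractivity_fewVars` LANDED (p167008, `…StubFewVarsBudget.lean`, unconditional).  Final state
of lead c3: `sorry` only in ♦ (`stub_stableLifting`, open core: many colour classes) and NH₁ (`stub_normHalvingOne`);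
32 tree files support the item (12 landed by this lead).

Rev 15 (lead c3): registers `stub_budgetOfContractivity_fewVars` — the UNCONDITIONAL crux-up-to-norm-budget for
`N ≤ 2 log₂(m+N) + 3` variables (size and norm both quasi-polynomial), provable now from Theorem A″ and the landed glue.

Rev 14 (lead c3): `stub_priceOfContractivity_fewVars` LANDED (p166312, `…StubFewVars.lean`): the crux restricted to
`N ≤ 2 log₂(m+N) + 3` variables is now a TREE THEOREM conditional on NH₁ alone.  `sorry` occurs only in the two
composing stubs ♦ (`stub_stableLifting`, open core: many colour classes) and NH₁ (`stub_normHalvingOne`); 31 tree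
files support the item (11 landed by this lead).

Rev 13 (lead c3): §2a‴ registers the conditional partial case of the CRUX that Theorem A″ makes available —
`stub_priceOfContractivity_fewVars`: NH₁ alone implies `PriceOfContractivity` restricted to
`N ≤ 2 log₂(m+N) + 3` variables (provable now: this file's composition with ♦ := fewColours).

Rev 12 (lead c3): THEOREM A″ HAS LANDED — `stub_stableLifting_fewColours` (♦ for at most `L + 1` colour classes of
arbitrary sizes, unconditional, `d = 3`; p164785, `…StubFewColours.lean`), assembled from the six landed pieces
W2–W6a; `sorry` again occurs ONLY in the two composing stubs `stub_stableLifting` (♦, open core now = MANY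
classes of size ≥ 2 / one large class + many singletons) and `stub_normHalvingOne` (NH₁); 29 tree files support
the item.

Rev 11 (lead c3, wave 2 integrated): the four rev-10 pieces have LANDED and are cited — W2
`piece3_schurExpansion` (p162132, `…StubFewColoursSchur.lean`), W3 `piece3_coeffBound` (p162382,
`…StubFewColoursCoeffBound.lean`), W4 `piece3_trie` (p162265, `…StubFewColoursTrie.lean`), W5
`piece3_assembly` (p162529, `…StubFewColoursAssembly.lean`); §2a″ registers the last intermediate piece W6a
`piece3_contentBounds` (the regrouped coefficient family with all bounds) before the final assembly of
`stub_stableLifting_fewColours` — LANDED as well (p163759, `…StubFewColoursContent.lean`), cited.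

Rev 10 (lead c3): §2a″ registers Theorem A″ — ♦ for at most `L + 1` colour classes of arbitrary
sizes (`stub_stableLifting_fewColours`, unconditional; settles the `(n,n,1)` frontier of
Lines/birth-lifting2.md) — and its four provable pieces W2 (general Schur expansion), W3
(coefficient bound by slicing + Cauchy), W4 (forest determinant identity), W5 (assembly).

Rev 9 (lead c3, wave 1 integrated): the four rev-8 pieces have LANDED and are cited from the tree —
`stub_normHalvingRescale` (NH₁ ⟹ NH_dom, `…StubNormHalvingRescale.lean`, p160379), `stub_normHalvingOne_twoColour`
(`…StubNormHalvingOneTwoColour.lean`, p160233, conditional on [GrinshpanEtAl2014, Thm 2.1]),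
`stub_minorBound_directSum` (`…StubMinorBoundDirectSum.lean`, p160009) and `stub_pencil_blockTriangular`
(`…StubPencilBlockTriangular.lean`, p159994).  `sorry` occurs ONLY in the two composing stubs
`stub_stableLifting` (♦) and `stub_normHalvingOne` (NH₁); 22 tree files support the item.

Rev 8 (lead c3): the load-bearing halving stub is now registered at ONE NORM SCALE and on the DOMAIN
the composition actually uses — `stub_normHalvingOne` (NH₁: `‖K‖ ≤ 2`, margin 2 ⟹ `‖K'‖ ≤ 1` at size
factor `2 ^ ((log₂ n + c)^c)`, for inputs of size `R ≤ 2 ^ ((log₂ n + c + 2)^(c+2))`), the weakest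
form the induction tolerates (Lines/birth-halving.md §1a, App. B).  The general-`M` form with the same
domain restriction (`Sig.stub_normHalvingDom`) is DERIVED from NH₁ by the rescaling glue
`stub_normHalvingRescale` (registered, provable: `x ↦ x/M`), and the composition runs the bit-budget
induction with the invariant `q^b · R ≤ Q(n)` (`priceInBudget_of_normHalvingDom`, proved here).  Three
further provable pieces are registered for landing: NH₁ for at most two colours (conditional on
[GrinshpanEtAl2014, Thm 2.1], inlined as for the landed two-colour ♦), the principal-minor bound for a
direct sum (♦ is closed under products) and the block-triangular pencil factorization with the norm of
a direct sum (NH is closed under products; both reduce the open cores to strongly connected supports).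
`sorry` occurs only in `stub_*` theorems; the composing stubs are exactly `stub_stableLifting` (♦) and
`stub_normHalvingOne` (NH₁), glued through `stub_normHalvingRescale`.

Rev 7 (end of lead c2): the rev-6 partial cases have LANDED (one-large-class lifting, unconditional —
four tree files; multiaffine halving regime) and are cited; `sorry` now occurs ONLY in the two
composing stubs `stub_stableLifting` (♦) and `stub_normHalving`: the crux is the glued split
PriceOfContractivity ⇐ ♦ ∧ NH with every other piece of the line landed (18 tree files,
`--supports stmt-ValiantsHypothesis-10583`).

Rev 6: the three rev-5 partial cases have LANDED (multiaffine balanced budget — unconditional;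
two-colour ♦ and two-variable crux — conditional on [GrinshpanEtAl2014, Thm 2.1]) and are cited;
§2e registers ♦ for one large colour class (paper proof Lines/birth-lifting2.md, unconditional) and
the multiaffine halving regime.

Rev 5: all five pieces of the cycle-mean bound (Theorem 4) have LANDED (tree files
`Theorems/ContractivityPricePriceOfContractivityStub{ArcStep,PermCounts,ArcInduction,CycleBalancing,CycleBound}.lean`)
and are cited in §2, so `stub_balancedBudget` is proved modulo the single norm-free stub
`stub_stableLifting` (♦); the composition is now closed modulo exactly {♦, `stub_normHalving`}.
§2d registers three further landing-grade partial cases (multiaffine budget; two colours of ♦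
and two variables of the crux, both conditional on [GrinshpanEtAl2014, Thm 2.1] taken as an
explicit hypothesis).

Rev 4: the balanced-budget step is no longer a stub.  It is PROVED (`balancedBudget_of`, §2c) from
(i) the norm-free core `stub_stableLifting` (♦: re-realize with all principal minors of `K₁` at most
`(2^((L+d)^d))^{|S|}` — equivalent to the old stub given (ii)), (ii) the CYCLE-MEAN BOUND
"max cycle geometric mean ≤ 240 R³ × principal-minor radius" (Theorem 4 of the wave-1 analysis,
`work/stubs/bb_notes.md`; registered in four provable pieces `stub_arcStep`, `stub_permCounts`,
`stub_arcInduction`, `stub_cycleBound`) and (iii) max-plus BALANCING by a positive diagonal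
similarity (`stub_cycleBalancing`), plus the glue proved here (pencil invariance under diagonal
similarity, entrywise ⟹ operator-norm bound, exponent arithmetic).  The five same-size partial
cases registered in rev 3 have LANDED (tree files
`Theorems/ContractivityPricePriceOfContractivityStubSameSize{UpperTriangular,SingleColour,RankOne,Normal,MonochromeBlocks}.lean`)
and are cited in §2b.

Route `ValiantsHypothesis/ContractivityPrice`, crux K1 (rank 2):
`Summit.ValiantsHypothesis.ValiantsHypothesis.Theses.ContractivityPrice.PriceOfContractivity` —
a polynomial `p` over `ℂ` in `≤ N` variables with an affine determinantal representation of size `m`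
and no zero on the closed polydisc of radius `2` has a CONTRACTIVE realization
`p = p(0) · det(1 + diag(x ∘ κ) · K)`, `‖K‖_op ≤ 1`, of size `R ≤ 2 ^ ((log₂ (m + N) + d) ^ d)`.

## The line (unchanged composition idea): Sylvester normal form ⟶ balanced budget ⟶ norm halving

Every realization is written in Sylvester normal form `det(1 + D_κ K)`, `D_κ = diag(x_{κ 1}, …, x_{κ R})`,
and measured by its SIZE `R` and its NORM BUDGET `log₂ ‖K‖_op` (bits); the crux asks for budget `0`
at quasi-polynomial size.

1. `normalForm_of_hasDetRepr` (PROVED): `HasDetRepr p m`, `p(0) ≠ 0` ⟹ `p = p(0)·det(1 + D_κ K₀)`,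
   `R ≤ #σ · m` (no norm information).
2. `stub_balancedBudget` (rev 4: PROVED from `stub_stableLifting` + the cycle-mean bound + balancing):
   a normal-form pencil of size `R ≤ 2 ^ L`, zero-free on the closed
   radius-2 polydisc, is re-realized (new size `R₁ ≤ 2 ^ ((L+d)^d)`, new colouring) with
   `‖K₁‖ ≤ 2 ^ ((L+d)^d)`: quasi-polynomially many bits of budget at quasi-polynomial size.
3. `stub_normHalving` (STUB, strengthen-to-induct): with `≥ 1` bit of budget (`‖K‖ ≤ 2M`, `M ≥ 1`)
   and margin-2 zero-freeness, ONE halving of the norm (`‖K'‖ ≤ M`) costs a size factor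
   `≤ 2 ^ ((log₂ n + c) ^ c)`, quasi-polynomial in a bound `n` on the number of variables and on the
   total degree of the pencil determinant (both invariant under re-realization, so the factor does
   not compound along the induction).
4. `priceInBudget_of_normHalving` (PROVED, induction on the bit budget `b`).
5. `exponent_bound₂` (PROVED, arithmetic) and `PriceOfContractivity_of :
   Sig.stub_balancedBudget → Sig.stub_normHalving → PriceOfContractivity` (PROVED).

## Reshape log (lead, rev 2)

Both stubs were WEAKENED to exactly what the composition consumes (any proof of the rev-1 stubs
proves these): rev-1 `stub_balancedBudget` demanded the SAME size and colouring (a quantitative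
`μ̄/μ`-gap statement at fixed dimension, stronger than needed); rev-1 `stub_normHalving` demanded
an ABSOLUTE constant size factor `c`, uniform in the number of variables and the degree (the card's
own Barriers section names the repair `R' ≤ q(N, deg) · R`).  The composition only needs (i) a
quasi-polynomial starting size/budget and (ii) a per-halving factor that does not compound with the
current size — a factor quasi-polynomial in (#variables, degree) compounds to
`q ^ b = 2 ^ (b · polylog)`, still quasi-polynomial.
-/

set_option linter.dupNamespace false

namespace Summit.ValiantsHypothesis.ValiantsHypothesis.Cruxes.PriceOfContractivity.Birth

open MvPolynomial Matrix
open Literature.Computability.AlgebraicComplexity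
open Summit.ValiantsHypothesis.ValiantsHypothesis.Theses.ContractivityPrice (PriceOfContractivity)
open Summit.ValiantsHypothesis.Theorems.PrincipalMinorColouring
  (det_add_linearPart_eq map_constantCoeff_shift)

/-! ## §1 The stub statements as named propositions

(The last name component of each `Sig.stub_*` is the registered stub's name, so that the composition
`PriceOfContractivity_of` takes the declared stubs BY NAME; the registered `theorem stub_*` below
spell the same statements out verbatim.) -/

namespace Sig

/-- **Stub 1** (balanced budget: quasi-polynomially many bits of norm at quasi-polynomial size). -/
def stub_balancedBudget : Prop :=
    ∃ d : ℕ, ∀ (L R : ℕ) {σ : Type} (K₀ : Matrix (Fin R) (Fin R) ℂ) (κ : Fin R → σ),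
      R ≤ 2 ^ L →
      (∀ z : σ → ℂ, (∀ j, ‖z j‖ ≤ 2) → MvPolynomial.eval z (1 + Matrix.diagonal (fun i => MvPolynomial.X (κ i)) * K₀.map (fun a : ℂ => (MvPolynomial.C a : MvPolynomial σ ℂ))).det ≠ 0) →
      ∃ R₁ ≤ 2 ^ ((L + d) ^ d), ∃ (K₁ : Matrix (Fin R₁) (Fin R₁) ℂ) (κ₁ : Fin R₁ → σ),
        ‖Matrix.toEuclideanCLM (𝕜 := ℂ) K₁‖ ≤ (2 : ℝ) ^ ((L + d) ^ d) ∧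
        (1 + Matrix.diagonal (fun i => MvPolynomial.X (κ i)) * K₀.map (fun a : ℂ => (MvPolynomial.C a : MvPolynomial σ ℂ))).det =
          (1 + Matrix.diagonal (fun i => MvPolynomial.X (κ₁ i)) * K₁.map (fun a : ℂ => (MvPolynomial.C a : MvPolynomial σ ℂ))).det

/-- **Stub 2** (norm halving at a size factor quasi-polynomial in #variables and degree; the
load-bearing analytic step). -/
def stub_normHalving : Prop :=
    ∃ c : ℕ, ∀ (n R : ℕ) (M : ℝ) {σ : Type} [Fintype σ] (K : Matrix (Fin R) (Fin R) ℂ) (κ : Fin R → σ),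
      Fintype.card σ ≤ n →
      (1 + Matrix.diagonal (fun i => MvPolynomial.X (κ i)) * K.map (fun a : ℂ => (MvPolynomial.C a : MvPolynomial σ ℂ))).det.totalDegree ≤ n →
      1 ≤ M →
      ‖Matrix.toEuclideanCLM (𝕜 := ℂ) K‖ ≤ 2 * M →
      (∀ z : σ → ℂ, (∀ j, ‖z j‖ ≤ 2) → MvPolynomial.eval z (1 + Matrix.diagonal (fun i => MvPolynomial.X (κ i)) * K.map (fun a : ℂ => (MvPolynomial.C a : MvPolynomial σ ℂ))).det ≠ 0) →
      ∃ R' ≤ 2 ^ ((Nat.log 2 n + c) ^ c) * R, ∃ (K' : Matrix (Fin R') (Fin R') ℂ) (κ' : Fin R' → σ),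
        ‖Matrix.toEuclideanCLM (𝕜 := ℂ) K'‖ ≤ M ∧
        (1 + Matrix.diagonal (fun i => MvPolynomial.X (κ i)) * K.map (fun a : ℂ => (MvPolynomial.C a : MvPolynomial σ ℂ))).det =
          (1 + Matrix.diagonal (fun i => MvPolynomial.X (κ' i)) * K'.map (fun a : ℂ => (MvPolynomial.C a : MvPolynomial σ ℂ))).det

/-- **Stub 2′ = NH₁ (rev 8; the registered composing form of the halving step).** Norm halving at ONE
norm scale (`‖K‖ ≤ 2 ⟹ ‖K'‖ ≤ 1`) at a size factor quasi-polynomial in the bound `n` on #variables and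
degree, for inputs in the domain `R ≤ 2 ^ ((log₂ n + c + 2) ^ (c + 2))` that the composition uses
(Lines/birth-halving.md §1a: `M` is a dummy parameter; App. B: the weakest restatement the induction
tolerates). -/
def stub_normHalvingOne : Prop :=
    ∃ c : ℕ, ∀ (n R : ℕ) {σ : Type} [Fintype σ] (K : Matrix (Fin R) (Fin R) ℂ) (κ : Fin R → σ),
      R ≤ 2 ^ ((Nat.log 2 n + c + 2) ^ (c + 2)) →
      Fintype.card σ ≤ n →
      (1 + Matrix.diagonal (fun i => MvPolynomial.X (κ i)) * K.map (fun a : ℂ => (MvPolynomial.C a : MvPolynomial σ ℂ))).det.totalDegree ≤ n →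
      ‖Matrix.toEuclideanCLM (𝕜 := ℂ) K‖ ≤ 2 →
      (∀ z : σ → ℂ, (∀ j, ‖z j‖ ≤ 2) → MvPolynomial.eval z (1 + Matrix.diagonal (fun i => MvPolynomial.X (κ i)) * K.map (fun a : ℂ => (MvPolynomial.C a : MvPolynomial σ ℂ))).det ≠ 0) →
      ∃ R' ≤ 2 ^ ((Nat.log 2 n + c) ^ c) * R, ∃ (K' : Matrix (Fin R') (Fin R') ℂ) (κ' : Fin R' → σ),
        ‖Matrix.toEuclideanCLM (𝕜 := ℂ) K'‖ ≤ 1 ∧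
        (1 + Matrix.diagonal (fun i => MvPolynomial.X (κ i)) * K.map (fun a : ℂ => (MvPolynomial.C a : MvPolynomial σ ℂ))).det =
          (1 + Matrix.diagonal (fun i => MvPolynomial.X (κ' i)) * K'.map (fun a : ℂ => (MvPolynomial.C a : MvPolynomial σ ℂ))).det

/-- **NH_dom (rev 8; derived).** The general-`M` halving step on the same domain: what the bit-budget
induction consumes; derived from NH₁ by rescaling (`stub_normHalvingRescale`). -/
def stub_normHalvingDom : Prop :=
    ∃ c : ℕ, ∀ (n R : ℕ) (M : ℝ) {σ : Type} [Fintype σ] (K : Matrix (Fin R) (Fin R) ℂ) (κ : Fin R → σ),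
      R ≤ 2 ^ ((Nat.log 2 n + c + 2) ^ (c + 2)) →
      Fintype.card σ ≤ n →
      (1 + Matrix.diagonal (fun i => MvPolynomial.X (κ i)) * K.map (fun a : ℂ => (MvPolynomial.C a : MvPolynomial σ ℂ))).det.totalDegree ≤ n →
      1 ≤ M →
      ‖Matrix.toEuclideanCLM (𝕜 := ℂ) K‖ ≤ 2 * M →
      (∀ z : σ → ℂ, (∀ j, ‖z j‖ ≤ 2) → MvPolynomial.eval z (1 + Matrix.diagonal (fun i => MvPolynomial.X (κ i)) * K.map (fun a : ℂ => (MvPolynomial.C a : MvPolynomial σ ℂ))).det ≠ 0) →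
      ∃ R' ≤ 2 ^ ((Nat.log 2 n + c) ^ c) * R, ∃ (K' : Matrix (Fin R') (Fin R') ℂ) (κ' : Fin R' → σ),
        ‖Matrix.toEuclideanCLM (𝕜 := ℂ) K'‖ ≤ M ∧
        (1 + Matrix.diagonal (fun i => MvPolynomial.X (κ i)) * K.map (fun a : ℂ => (MvPolynomial.C a : MvPolynomial σ ℂ))).det =
          (1 + Matrix.diagonal (fun i => MvPolynomial.X (κ' i)) * K'.map (fun a : ℂ => (MvPolynomial.C a : MvPolynomial σ ℂ))).det

/-- **Stub ♦ (stable determinantal lifting; the norm-free core of the balanced budget).** A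
margin-2 zero-free Sylvester pencil of size `R ≤ 2 ^ L` is re-realized at size
`R₁ ≤ 2 ^ ((L+d)^d)` by a matrix ALL of whose principal minors (indexed by injective
`w : Fin (k+1) → Fin R₁`) have modulus `≤ (2 ^ ((L+d)^d)) ^ (k+1)` — i.e. whose multiaffine lift
is zero-free on the polydisc of radius `2 ^ (-polylog)`.  Equivalent to the rev-3
`stub_balancedBudget` given the cycle-mean bound (Hadamard in one direction, `balancedBudget_of`
in the other); trivially true for injective `κ` (`K₁ = K₀`, minors `< 2^{-|S|}`). -/
def stub_stableLifting : Prop :=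
    ∃ d : ℕ, ∀ (L R : ℕ) {σ : Type} (K₀ : Matrix (Fin R) (Fin R) ℂ) (κ : Fin R → σ),
      R ≤ 2 ^ L →
      (∀ z : σ → ℂ, (∀ j, ‖z j‖ ≤ 2) → MvPolynomial.eval z (1 + Matrix.diagonal (fun i => MvPolynomial.X (κ i)) * K₀.map (fun a : ℂ => (MvPolynomial.C a : MvPolynomial σ ℂ))).det ≠ 0) →
      ∃ R₁ ≤ 2 ^ ((L + d) ^ d), ∃ (K₁ : Matrix (Fin R₁) (Fin R₁) ℂ) (κ₁ : Fin R₁ → σ),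
        (∀ (k : ℕ) (w : Fin (k + 1) → Fin R₁), Function.Injective w →
          ‖(K₁.submatrix w w).det‖ ≤ ((2 : ℝ) ^ ((L + d) ^ d)) ^ (k + 1)) ∧
        (1 + Matrix.diagonal (fun i => MvPolynomial.X (κ i)) * K₀.map (fun a : ℂ => (MvPolynomial.C a : MvPolynomial σ ℂ))).det =
          (1 + Matrix.diagonal (fun i => MvPolynomial.X (κ₁ i)) * K₁.map (fun a : ℂ => (MvPolynomial.C a : MvPolynomial σ ℂ))).det

/-- **Piece P1 (arc step).** One step of the arc induction on an `(m+1) × (m+1)` block `A` with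
unit superdiagonal, forward entries `≤ 1`, `|det A| ≤ δ^{m+1}` and shorter backward entries bounded
by `y`: the corner entry satisfies `‖A m 0‖ ≤ y m`, provided the two permutation sums are small
(`det A = A_{m0}·Q + R'` by the Leibniz expansion split on `σ 0 = m`; `|R'| ≤ Φ`, `|Q| ≥ 1 − Ψ`). -/
def arcStep : Prop :=
    ∀ (m : ℕ) (A : Matrix (Fin (m + 1)) (Fin (m + 1)) ℂ) (y : ℕ → ℝ) (δ : ℝ),
      1 ≤ m → 0 ≤ δ → (∀ l, 0 ≤ y l) →
      (∀ (t : ℕ) (h : t + 1 < m + 1), A ⟨t, by omega⟩ ⟨t + 1, h⟩ = 1) →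
      (∀ i j : Fin (m + 1), i.val < j.val → ‖A i j‖ ≤ 1) →
      ‖A.det‖ ≤ δ ^ (m + 1) →
      (∀ i j : Fin (m + 1), j.val ≤ i.val → i.val - j.val < m → ‖A i j‖ ≤ y (i.val - j.val)) →
      δ ^ (m + 1) ≤ y m / 4 →
      (∑ σ ∈ (Finset.univ : Finset (Equiv.Perm (Fin (m + 1)))).filter (fun σ => σ 0 ≠ Fin.last m),
          ∏ i ∈ (Finset.univ : Finset (Fin (m + 1))).filter (fun i => i.val ≤ (σ i).val),
            y ((σ i).val - i.val)) ≤ y m / 4 →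
      (∑ σ ∈ (Finset.univ : Finset (Equiv.Perm (Fin (m + 1)))).filter (fun σ => σ 0 = Fin.last m),
          ∏ i ∈ (Finset.univ : Finset (Fin (m + 1))).filter (fun i => i ≠ 0 ∧ i.val ≤ (σ i).val),
            y ((σ i).val - i.val)) ≤ 3 / 2 →
      ‖A (Fin.last m) 0‖ ≤ y m

/-- **Piece P23 (permutation counts).** With `Λ = 16 n`, `y_l = Λ^l δ^{l+1}`, `m + 1 ≤ n` and
`δ ≤ 1/(240 n³)`: `Φ_m(y) ≤ y_m / 4` (sum over `σ 0 ≠ m` of the products of `y_{σ i − i}` over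
weak excedances) and `Σ_{σ 0 = m} Π_{i ≠ 0, i ≤ σ i} y_{σ i − i} ≤ 3/2` (the rotation contributes
`1`, the rest `≤ 1/2`).  Counting by surplus / number of non-forward positions. -/
def permCounts : Prop :=
    ∀ (n m : ℕ) (δ : ℝ), 1 ≤ m → m + 1 ≤ n → 0 ≤ δ → δ ≤ 1 / (240 * (n : ℝ) ^ 3) →
      (∑ σ ∈ (Finset.univ : Finset (Equiv.Perm (Fin (m + 1)))).filter (fun σ => σ 0 ≠ Fin.last m),
          ∏ i ∈ (Finset.univ : Finset (Fin (m + 1))).filter (fun i => i.val ≤ (σ i).val),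
            (16 * (n : ℝ)) ^ ((σ i).val - i.val) * δ ^ ((σ i).val - i.val + 1)) ≤
          (16 * (n : ℝ)) ^ m * δ ^ (m + 1) / 4 ∧
      (∑ σ ∈ (Finset.univ : Finset (Equiv.Perm (Fin (m + 1)))).filter (fun σ => σ 0 = Fin.last m),
          ∏ i ∈ (Finset.univ : Finset (Fin (m + 1))).filter (fun i => i ≠ 0 ∧ i.val ≤ (σ i).val),
            (16 * (n : ℝ)) ^ ((σ i).val - i.val) * δ ^ ((σ i).val - i.val + 1)) ≤ 3 / 2

/-- **Lemma 2 (arc bound).** For an `n × n` matrix (`n ≥ 2`) with unit superdiagonal, all entries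
of modulus `≤ 1` and every INTERVAL principal minor `|det B[a..a+k]| ≤ δ^{k+1}`,
`δ ≤ 1/(240 n³)`: every backward entry is tiny, `‖B (a+k) a‖ ≤ (16 n)^k δ^{k+1}`. -/
def arcBound : Prop :=
    ∀ (n : ℕ) (B : Matrix (Fin n) (Fin n) ℂ) (δ : ℝ), 2 ≤ n → 0 ≤ δ → δ ≤ 1 / (240 * (n : ℝ) ^ 3) →
      (∀ (t : ℕ) (h : t + 1 < n), B ⟨t, by omega⟩ ⟨t + 1, h⟩ = 1) →
      (∀ i j : Fin n, ‖B i j‖ ≤ 1) →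
      (∀ (a k : ℕ) (h : a + k < n),
        ‖(B.submatrix (fun i : Fin (k + 1) => (⟨a + i.val, by omega⟩ : Fin n))
          (fun i : Fin (k + 1) => (⟨a + i.val, by omega⟩ : Fin n))).det‖ ≤ δ ^ (k + 1)) →
      ∀ (a k : ℕ) (h : a + k < n), ‖B ⟨a + k, h⟩ ⟨a, by omega⟩‖ ≤ (16 * (n : ℝ)) ^ k * δ ^ (k + 1)

/-- **Lemma 1 (max-plus balancing).** If every cycle product of `K` (cycles as injective
`v : Fin (n+1) → Fin R`, edges `v t → v (t+1)` cyclically, loops included) has modulus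
`≤ M^{n+1}`, `M > 0`, then a positive diagonal similarity makes every entry `≤ M`:
`d i · ‖K i j‖ / d j ≤ M` (potentials = best path values). -/
def balancing : Prop :=
    ∀ (R : ℕ) (K : Matrix (Fin R) (Fin R) ℂ) (M : ℝ), 0 < M →
      (∀ (n : ℕ) (v : Fin (n + 1) → Fin R), Function.Injective v →
        ‖∏ t : Fin (n + 1), K (v t) (v (t + 1))‖ ≤ M ^ (n + 1)) →
      ∃ d : Fin R → ℝ, (∀ i, 0 < d i) ∧ ∀ i j, d i * ‖K i j‖ / d j ≤ M

/-- **Theorem 4 (cycle-mean bound).** If all principal minors of `K` satisfy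
`|det K[w]| ≤ ν^{k+1}` (`w : Fin (k+1) → Fin R` injective) then every cycle product satisfies
`|∏ K (v t) (v (t+1))| ≤ (240 R³ ν)^{n+1}`: the max cycle geometric mean is at most `240 R³`
times the principal-minor radius. -/
def cycleBound : Prop :=
    ∀ (R : ℕ) (K : Matrix (Fin R) (Fin R) ℂ) (ν : ℝ), 0 ≤ ν →
      (∀ (k : ℕ) (w : Fin (k + 1) → Fin R), Function.Injective w →
        ‖(K.submatrix w w).det‖ ≤ ν ^ (k + 1)) →
      ∀ (n : ℕ) (v : Fin (n + 1) → Fin R), Function.Injective v →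
        ‖∏ t : Fin (n + 1), K (v t) (v (t + 1))‖ ≤ (240 * (R : ℝ) ^ 3 * ν) ^ (n + 1)

end Sig

/-! ## §2 The registered stubs (statements spelled out; `sorry` lives only here) -/

/-- **Stub ♦ (stable determinantal lifting).** A Sylvester pencil `det(1 + D_κ K₀)` of size
`R ≤ 2 ^ L` with no zero on the closed polydisc of radius `2` admits a re-realization
`det(1 + D_κ K₀) = det(1 + D_{κ₁} K₁)` of size `R₁ ≤ 2 ^ ((L + d) ^ d)` ALL of whose principal
minors are at most `(2 ^ ((L + d) ^ d)) ^ {size}` (the norm-free content of the balanced budget: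
with the cycle-mean bound and balancing it gives `‖D K₁ D⁻¹‖ ≤ 2 ^ polylog`, §2c). -/
theorem stub_stableLifting :
    ∃ d : ℕ, ∀ (L R : ℕ) {σ : Type} (K₀ : Matrix (Fin R) (Fin R) ℂ) (κ : Fin R → σ),
      R ≤ 2 ^ L →
      (∀ z : σ → ℂ, (∀ j, ‖z j‖ ≤ 2) → MvPolynomial.eval z (1 + Matrix.diagonal (fun i => MvPolynomial.X (κ i)) * K₀.map (fun a : ℂ => (MvPolynomial.C a : MvPolynomial σ ℂ))).det ≠ 0) →
      ∃ R₁ ≤ 2 ^ ((L + d) ^ d), ∃ (K₁ : Matrix (Fin R₁) (Fin R₁) ℂ) (κ₁ : Fin R₁ → σ),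
        (∀ (k : ℕ) (w : Fin (k + 1) → Fin R₁), Function.Injective w →
          ‖(K₁.submatrix w w).det‖ ≤ ((2 : ℝ) ^ ((L + d) ^ d)) ^ (k + 1)) ∧
        (1 + Matrix.diagonal (fun i => MvPolynomial.X (κ i)) * K₀.map (fun a : ℂ => (MvPolynomial.C a : MvPolynomial σ ℂ))).det =
          (1 + Matrix.diagonal (fun i => MvPolynomial.X (κ₁ i)) * K₁.map (fun a : ℂ => (MvPolynomial.C a : MvPolynomial σ ℂ))).det := by
  sorry

/-- **Stub P1 (arc step).** One step of the arc induction (Leibniz expansion split on `σ 0 = m`;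
see `Sig.arcStep`). -/
theorem stub_arcStep :
    ∀ (m : ℕ) (A : Matrix (Fin (m + 1)) (Fin (m + 1)) ℂ) (y : ℕ → ℝ) (δ : ℝ),
      1 ≤ m → 0 ≤ δ → (∀ l, 0 ≤ y l) →
      (∀ (t : ℕ) (h : t + 1 < m + 1), A ⟨t, by omega⟩ ⟨t + 1, h⟩ = 1) →
      (∀ i j : Fin (m + 1), i.val < j.val → ‖A i j‖ ≤ 1) →
      ‖A.det‖ ≤ δ ^ (m + 1) →
      (∀ i j : Fin (m + 1), j.val ≤ i.val → i.val - j.val < m → ‖A i j‖ ≤ y (i.val - j.val)) →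
      δ ^ (m + 1) ≤ y m / 4 →
      (∑ σ ∈ (Finset.univ : Finset (Equiv.Perm (Fin (m + 1)))).filter (fun σ => σ 0 ≠ Fin.last m),
          ∏ i ∈ (Finset.univ : Finset (Fin (m + 1))).filter (fun i => i.val ≤ (σ i).val),
            y ((σ i).val - i.val)) ≤ y m / 4 →
      (∑ σ ∈ (Finset.univ : Finset (Equiv.Perm (Fin (m + 1)))).filter (fun σ => σ 0 = Fin.last m),
          ∏ i ∈ (Finset.univ : Finset (Fin (m + 1))).filter (fun i => i ≠ 0 ∧ i.val ≤ (σ i).val),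
            y ((σ i).val - i.val)) ≤ 3 / 2 →
      ‖A (Fin.last m) 0‖ ≤ y m :=
  Summit.ValiantsHypothesis.ValiantsHypothesis.Theorems.PriceOfContractivity.ArcStep.stub_arcStep

/-- **Stub P23 (permutation counts).** The two counting estimates of the arc induction at
`Λ = 16 n`, `y_l = Λ^l δ^{l+1}`, `δ ≤ 1/(240 n³)` (see `Sig.permCounts`). -/
theorem stub_permCounts :
    ∀ (n m : ℕ) (δ : ℝ), 1 ≤ m → m + 1 ≤ n → 0 ≤ δ → δ ≤ 1 / (240 * (n : ℝ) ^ 3) →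
      (∑ σ ∈ (Finset.univ : Finset (Equiv.Perm (Fin (m + 1)))).filter (fun σ => σ 0 ≠ Fin.last m),
          ∏ i ∈ (Finset.univ : Finset (Fin (m + 1))).filter (fun i => i.val ≤ (σ i).val),
            (16 * (n : ℝ)) ^ ((σ i).val - i.val) * δ ^ ((σ i).val - i.val + 1)) ≤
          (16 * (n : ℝ)) ^ m * δ ^ (m + 1) / 4 ∧
      (∑ σ ∈ (Finset.univ : Finset (Equiv.Perm (Fin (m + 1)))).filter (fun σ => σ 0 = Fin.last m),
          ∏ i ∈ (Finset.univ : Finset (Fin (m + 1))).filter (fun i => i ≠ 0 ∧ i.val ≤ (σ i).val),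
            (16 * (n : ℝ)) ^ ((σ i).val - i.val) * δ ^ ((σ i).val - i.val + 1)) ≤ 3 / 2 :=
  Summit.ValiantsHypothesis.ValiantsHypothesis.Theorems.PriceOfContractivity.PermCounts.stub_permCounts

/-- **Stub P4 (arc induction = Lemma 2 from the step and the counts).** Strong induction on the
arc length `k`, applying the step to the interval block `B[a..a+k]` reindexed to `Fin (k+1)`
with `y_l = (16 n)^l δ^{l+1}`. Hypotheses: the statements of `stub_arcStep` and `stub_permCounts`
verbatim. -/
theorem stub_arcInduction :
    (∀ (m : ℕ) (A : Matrix (Fin (m + 1)) (Fin (m + 1)) ℂ) (y : ℕ → ℝ) (δ : ℝ),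
      1 ≤ m → 0 ≤ δ → (∀ l, 0 ≤ y l) →
      (∀ (t : ℕ) (h : t + 1 < m + 1), A ⟨t, by omega⟩ ⟨t + 1, h⟩ = 1) →
      (∀ i j : Fin (m + 1), i.val < j.val → ‖A i j‖ ≤ 1) →
      ‖A.det‖ ≤ δ ^ (m + 1) →
      (∀ i j : Fin (m + 1), j.val ≤ i.val → i.val - j.val < m → ‖A i j‖ ≤ y (i.val - j.val)) →
      δ ^ (m + 1) ≤ y m / 4 →
      (∑ σ ∈ (Finset.univ : Finset (Equiv.Perm (Fin (m + 1)))).filter (fun σ => σ 0 ≠ Fin.last m),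
          ∏ i ∈ (Finset.univ : Finset (Fin (m + 1))).filter (fun i => i.val ≤ (σ i).val),
            y ((σ i).val - i.val)) ≤ y m / 4 →
      (∑ σ ∈ (Finset.univ : Finset (Equiv.Perm (Fin (m + 1)))).filter (fun σ => σ 0 = Fin.last m),
          ∏ i ∈ (Finset.univ : Finset (Fin (m + 1))).filter (fun i => i ≠ 0 ∧ i.val ≤ (σ i).val),
            y ((σ i).val - i.val)) ≤ 3 / 2 →
      ‖A (Fin.last m) 0‖ ≤ y m) →
    (∀ (n m : ℕ) (δ : ℝ), 1 ≤ m → m + 1 ≤ n → 0 ≤ δ → δ ≤ 1 / (240 * (n : ℝ) ^ 3) →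
      (∑ σ ∈ (Finset.univ : Finset (Equiv.Perm (Fin (m + 1)))).filter (fun σ => σ 0 ≠ Fin.last m),
          ∏ i ∈ (Finset.univ : Finset (Fin (m + 1))).filter (fun i => i.val ≤ (σ i).val),
            (16 * (n : ℝ)) ^ ((σ i).val - i.val) * δ ^ ((σ i).val - i.val + 1)) ≤
          (16 * (n : ℝ)) ^ m * δ ^ (m + 1) / 4 ∧
      (∑ σ ∈ (Finset.univ : Finset (Equiv.Perm (Fin (m + 1)))).filter (fun σ => σ 0 = Fin.last m),
          ∏ i ∈ (Finset.univ : Finset (Fin (m + 1))).filter (fun i => i ≠ 0 ∧ i.val ≤ (σ i).val),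
            (16 * (n : ℝ)) ^ ((σ i).val - i.val) * δ ^ ((σ i).val - i.val + 1)) ≤ 3 / 2) →
    ∀ (n : ℕ) (B : Matrix (Fin n) (Fin n) ℂ) (δ : ℝ), 2 ≤ n → 0 ≤ δ → δ ≤ 1 / (240 * (n : ℝ) ^ 3) →
      (∀ (t : ℕ) (h : t + 1 < n), B ⟨t, by omega⟩ ⟨t + 1, h⟩ = 1) →
      (∀ i j : Fin n, ‖B i j‖ ≤ 1) →
      (∀ (a k : ℕ) (h : a + k < n),
        ‖(B.submatrix (fun i : Fin (k + 1) => (⟨a + i.val, by omega⟩ : Fin n))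
          (fun i : Fin (k + 1) => (⟨a + i.val, by omega⟩ : Fin n))).det‖ ≤ δ ^ (k + 1)) →
      ∀ (a k : ℕ) (h : a + k < n), ‖B ⟨a + k, h⟩ ⟨a, by omega⟩‖ ≤ (16 * (n : ℝ)) ^ k * δ ^ (k + 1) :=
  Summit.ValiantsHypothesis.ValiantsHypothesis.Theorems.PriceOfContractivity.ArcInduction.stub_arcInduction

/-- **Stub P5 (max-plus balancing, Lemma 1).** Cycle products `≤ M^{length}` ⟹ a positive
diagonal similarity with all entries `≤ M` (see `Sig.balancing`). -/
theorem stub_cycleBalancing :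
    ∀ (R : ℕ) (K : Matrix (Fin R) (Fin R) ℂ) (M : ℝ), 0 < M →
      (∀ (n : ℕ) (v : Fin (n + 1) → Fin R), Function.Injective v →
        ‖∏ t : Fin (n + 1), K (v t) (v (t + 1))‖ ≤ M ^ (n + 1)) →
      ∃ d : Fin R → ℝ, (∀ i, 0 < d i) ∧ ∀ i j, d i * ‖K i j‖ / d j ≤ M :=
  Summit.ValiantsHypothesis.ValiantsHypothesis.Theorems.PriceOfContractivity.CycleBalancing.stub_cycleBalancing

/-- **Stub P6 (Theorem 4 from balancing and the arc bound).** Reduction: let `γ` be the max cycle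
geometric mean, attained on a cycle `C` of length `k ≥ 2` (loops are minors); balance at level `γ`
(all entries `≤ γ`, the edges of `C` then have modulus exactly `γ`), normalise by `γ`, restrict to
`V(C)` in cyclic order, conjugate by diagonal phases to make the superdiagonal `1`; interval minors
are `≤ (ν/γ)^{size}`, so the arc bound with `δ = ν/γ ≤ 1/(240 k³)` would force the closing edge
`‖B (k-1) 0‖ < 1`, contradiction; hence `γ < 240 k³ ν ≤ 240 R³ ν`. Hypotheses: the statements
of `stub_cycleBalancing` and of Lemma 2 (`stub_arcInduction`'s conclusion) verbatim. -/
theorem stub_cycleBound :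
    (∀ (R : ℕ) (K : Matrix (Fin R) (Fin R) ℂ) (M : ℝ), 0 < M →
      (∀ (n : ℕ) (v : Fin (n + 1) → Fin R), Function.Injective v →
        ‖∏ t : Fin (n + 1), K (v t) (v (t + 1))‖ ≤ M ^ (n + 1)) →
      ∃ d : Fin R → ℝ, (∀ i, 0 < d i) ∧ ∀ i j, d i * ‖K i j‖ / d j ≤ M) →
    (∀ (n : ℕ) (B : Matrix (Fin n) (Fin n) ℂ) (δ : ℝ), 2 ≤ n → 0 ≤ δ → δ ≤ 1 / (240 * (n : ℝ) ^ 3) →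
      (∀ (t : ℕ) (h : t + 1 < n), B ⟨t, by omega⟩ ⟨t + 1, h⟩ = 1) →
      (∀ i j : Fin n, ‖B i j‖ ≤ 1) →
      (∀ (a k : ℕ) (h : a + k < n),
        ‖(B.submatrix (fun i : Fin (k + 1) => (⟨a + i.val, by omega⟩ : Fin n))
          (fun i : Fin (k + 1) => (⟨a + i.val, by omega⟩ : Fin n))).det‖ ≤ δ ^ (k + 1)) →
      ∀ (a k : ℕ) (h : a + k < n), ‖B ⟨a + k, h⟩ ⟨a, by omega⟩‖ ≤ (16 * (n : ℝ)) ^ k * δ ^ (k + 1)) →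
    ∀ (R : ℕ) (K : Matrix (Fin R) (Fin R) ℂ) (ν : ℝ), 0 ≤ ν →
      (∀ (k : ℕ) (w : Fin (k + 1) → Fin R), Function.Injective w →
        ‖(K.submatrix w w).det‖ ≤ ν ^ (k + 1)) →
      ∀ (n : ℕ) (v : Fin (n + 1) → Fin R), Function.Injective v →
        ‖∏ t : Fin (n + 1), K (v t) (v (t + 1))‖ ≤ (240 * (R : ℝ) ^ 3 * ν) ^ (n + 1) :=
  Summit.ValiantsHypothesis.ValiantsHypothesis.Theorems.PriceOfContractivity.CycleBound.stub_cycleBound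

/-- **Stub 2′ = NH₁ (rev 8; the composing halving stub, one norm scale, composition domain).** There is
an absolute `c` such that a Sylvester pencil of size `R ≤ 2 ^ ((log₂ n + c + 2) ^ (c + 2))` in `≤ n`
variables whose determinant has total degree `≤ n`, zero-free on the closed polydisc of radius `2`
and realized with `‖K‖ ≤ 2`, is re-realized (same polynomial; new size, matrix and colouring) with
`‖K'‖ ≤ 1` at size `R' ≤ 2 ^ ((log₂ n + c) ^ c) · R`.  (The rev-2…7 stub `stub_normHalving` — all
`M ≥ 1`, no domain restriction — implies it trivially; conversely NH₁ gives the general-`M` form on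
the same domain by the rescaling `x ↦ x / M`, `stub_normHalvingRescale`.) -/
theorem stub_normHalvingOne :
    ∃ c : ℕ, ∀ (n R : ℕ) {σ : Type} [Fintype σ] (K : Matrix (Fin R) (Fin R) ℂ) (κ : Fin R → σ),
      R ≤ 2 ^ ((Nat.log 2 n + c + 2) ^ (c + 2)) →
      Fintype.card σ ≤ n →
      (1 + Matrix.diagonal (fun i => MvPolynomial.X (κ i)) * K.map (fun a : ℂ => (MvPolynomial.C a : MvPolynomial σ ℂ))).det.totalDegree ≤ n →
      ‖Matrix.toEuclideanCLM (𝕜 := ℂ) K‖ ≤ 2 →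
      (∀ z : σ → ℂ, (∀ j, ‖z j‖ ≤ 2) → MvPolynomial.eval z (1 + Matrix.diagonal (fun i => MvPolynomial.X (κ i)) * K.map (fun a : ℂ => (MvPolynomial.C a : MvPolynomial σ ℂ))).det ≠ 0) →
      ∃ R' ≤ 2 ^ ((Nat.log 2 n + c) ^ c) * R, ∃ (K' : Matrix (Fin R') (Fin R') ℂ) (κ' : Fin R' → σ),
        ‖Matrix.toEuclideanCLM (𝕜 := ℂ) K'‖ ≤ 1 ∧
        (1 + Matrix.diagonal (fun i => MvPolynomial.X (κ i)) * K.map (fun a : ℂ => (MvPolynomial.C a : MvPolynomial σ ℂ))).det =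
          (1 + Matrix.diagonal (fun i => MvPolynomial.X (κ' i)) * K'.map (fun a : ℂ => (MvPolynomial.C a : MvPolynomial σ ℂ))).det := by
  sorry

/-- **Stub (rescaling glue, rev 8): NH₁ ⟹ NH_dom.** The norm scale `M ≥ 1` is a dummy parameter:
given `‖K‖ ≤ 2M`, the pencil of `M⁻¹ K` is the image of the pencil of `K` under the algebra map
`x_j ↦ M⁻¹ x_j` (same support, same total degree, zero-free on the closed radius-2 polydisc because
`‖z / M‖ ≤ 2`), NH₁ re-realizes it with `‖K''‖ ≤ 1`, and the inverse map `x_j ↦ M x_j` turns that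
into a realization `M K''` of the original pencil with `‖M K''‖ ≤ M` (Lines/birth-halving.md §1a).
Both statements are spelled out verbatim (`Sig.stub_normHalvingOne → Sig.stub_normHalvingDom`). -/
theorem stub_normHalvingRescale :
    (∃ c : ℕ, ∀ (n R : ℕ) {σ : Type} [Fintype σ] (K : Matrix (Fin R) (Fin R) ℂ) (κ : Fin R → σ),
      R ≤ 2 ^ ((Nat.log 2 n + c + 2) ^ (c + 2)) →
      Fintype.card σ ≤ n →
      (1 + Matrix.diagonal (fun i => MvPolynomial.X (κ i)) * K.map (fun a : ℂ => (MvPolynomial.C a : MvPolynomial σ ℂ))).det.totalDegree ≤ n →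
      ‖Matrix.toEuclideanCLM (𝕜 := ℂ) K‖ ≤ 2 →
      (∀ z : σ → ℂ, (∀ j, ‖z j‖ ≤ 2) → MvPolynomial.eval z (1 + Matrix.diagonal (fun i => MvPolynomial.X (κ i)) * K.map (fun a : ℂ => (MvPolynomial.C a : MvPolynomial σ ℂ))).det ≠ 0) →
      ∃ R' ≤ 2 ^ ((Nat.log 2 n + c) ^ c) * R, ∃ (K' : Matrix (Fin R') (Fin R') ℂ) (κ' : Fin R' → σ),
        ‖Matrix.toEuclideanCLM (𝕜 := ℂ) K'‖ ≤ 1 ∧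
        (1 + Matrix.diagonal (fun i => MvPolynomial.X (κ i)) * K.map (fun a : ℂ => (MvPolynomial.C a : MvPolynomial σ ℂ))).det =
          (1 + Matrix.diagonal (fun i => MvPolynomial.X (κ' i)) * K'.map (fun a : ℂ => (MvPolynomial.C a : MvPolynomial σ ℂ))).det) →
    ∃ c : ℕ, ∀ (n R : ℕ) (M : ℝ) {σ : Type} [Fintype σ] (K : Matrix (Fin R) (Fin R) ℂ) (κ : Fin R → σ),
      R ≤ 2 ^ ((Nat.log 2 n + c + 2) ^ (c + 2)) →
      Fintype.card σ ≤ n →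
      (1 + Matrix.diagonal (fun i => MvPolynomial.X (κ i)) * K.map (fun a : ℂ => (MvPolynomial.C a : MvPolynomial σ ℂ))).det.totalDegree ≤ n →
      1 ≤ M →
      ‖Matrix.toEuclideanCLM (𝕜 := ℂ) K‖ ≤ 2 * M →
      (∀ z : σ → ℂ, (∀ j, ‖z j‖ ≤ 2) → MvPolynomial.eval z (1 + Matrix.diagonal (fun i => MvPolynomial.X (κ i)) * K.map (fun a : ℂ => (MvPolynomial.C a : MvPolynomial σ ℂ))).det ≠ 0) →
      ∃ R' ≤ 2 ^ ((Nat.log 2 n + c) ^ c) * R, ∃ (K' : Matrix (Fin R') (Fin R') ℂ) (κ' : Fin R' → σ),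
        ‖Matrix.toEuclideanCLM (𝕜 := ℂ) K'‖ ≤ M ∧
        (1 + Matrix.diagonal (fun i => MvPolynomial.X (κ i)) * K.map (fun a : ℂ => (MvPolynomial.C a : MvPolynomial σ ℂ))).det =
          (1 + Matrix.diagonal (fun i => MvPolynomial.X (κ' i)) * K'.map (fun a : ℂ => (MvPolynomial.C a : MvPolynomial σ ℂ))).det :=
  Summit.ValiantsHypothesis.ValiantsHypothesis.Theorems.PriceOfContractivity.NormHalvingRescale.stub_normHalvingRescale

/-! ## §2a′ Registered partial cases and structural pieces (rev 8): NH₁ for two colours; products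

`stub_normHalvingOne_twoColour`: NH₁ when `κ` takes at most two values, conditional on the published
two-variable realization theorem [GrinshpanEtAl2014, Thm. 2.1] inlined verbatim exactly as in the landed
`Theorems/ContractivityPricePriceOfContractivityStubStableLiftingTwoColour.lean` (size `deg₀ + deg₁ ≤ 2R`,
`‖K'‖ ≤ 1/2 ≤ 1`, so `c = 1`).  `stub_minorBound_directSum`: the principal minors of a direct sum
`K₁ ⊕ K₂` obey the bound `B^{size}` when those of `K₁` and `K₂` do (♦ is closed under products of
pencils).  `stub_pencil_blockTriangular`: the Sylvester pencil of a block upper-triangular matrix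
factorizes as the product of the pencils of its diagonal blocks, and the operator norm of a direct sum
is the max of the norms (NH is closed under products; both stubs reduce to strongly connected
supports of `K`). -/

/-- **Partial case (NH₁, at most two colours), conditional on [GrinshpanEtAl2014, Thm. 2.1]** (first
hypothesis, verbatim as in the landed two-colour ♦ file).  With colours `a, b` the pencil determinant
is a renamed bivariate polynomial with no zero on the closed radius-2 bidisc and total degree `≤ R`,
so the theorem at `r = 2` re-realizes it with `‖K'‖ ≤ 1/2 ≤ 1` at size `deg₀ + deg₁ ≤ 2R ≤
2 ^ ((log₂ n + 1) ^ 1) · R` (`c = 1`; the empty matrix when it is constant). -/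
theorem stub_normHalvingOne_twoColour :
    (∀ (p : MvPolynomial (Fin 2) ℂ) (r : ℝ), 0 < r →
      MvPolynomial.eval (0 : Fin 2 → ℂ) p = 1 → 0 < p.totalDegree →
      (∀ z : Fin 2 → ℂ, (∀ j, ‖z j‖ < r) → MvPolynomial.eval z p ≠ 0) →
      ∃ (K : Matrix (Fin (p.degreeOf 0 + p.degreeOf 1)) (Fin (p.degreeOf 0 + p.degreeOf 1)) ℂ)
        (κ : Fin (p.degreeOf 0 + p.degreeOf 1) → Fin 2),
        (∀ j : Fin 2, (Finset.univ.filter fun i => κ i = j).card = p.degreeOf j) ∧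
        ‖Matrix.toEuclideanCLM (𝕜 := ℂ) K‖ ≤ r⁻¹ ∧
        p = (1 + Matrix.diagonal (fun i => MvPolynomial.X (κ i)) *
              K.map (fun a : ℂ => (MvPolynomial.C a : MvPolynomial (Fin 2) ℂ))).det) →
    ∃ c : ℕ, ∀ (n R : ℕ) {σ : Type} [Fintype σ] (K : Matrix (Fin R) (Fin R) ℂ) (κ : Fin R → σ),
      (∃ a b : σ, ∀ i, κ i = a ∨ κ i = b) →
      R ≤ 2 ^ ((Nat.log 2 n + c + 2) ^ (c + 2)) →
      Fintype.card σ ≤ n →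
      (1 + Matrix.diagonal (fun i => MvPolynomial.X (κ i)) * K.map (fun a : ℂ => (MvPolynomial.C a : MvPolynomial σ ℂ))).det.totalDegree ≤ n →
      ‖Matrix.toEuclideanCLM (𝕜 := ℂ) K‖ ≤ 2 →
      (∀ z : σ → ℂ, (∀ j, ‖z j‖ ≤ 2) → MvPolynomial.eval z (1 + Matrix.diagonal (fun i => MvPolynomial.X (κ i)) * K.map (fun a : ℂ => (MvPolynomial.C a : MvPolynomial σ ℂ))).det ≠ 0) →
      ∃ R' ≤ 2 ^ ((Nat.log 2 n + c) ^ c) * R, ∃ (K' : Matrix (Fin R') (Fin R') ℂ) (κ' : Fin R' → σ),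
        ‖Matrix.toEuclideanCLM (𝕜 := ℂ) K'‖ ≤ 1 ∧
        (1 + Matrix.diagonal (fun i => MvPolynomial.X (κ i)) * K.map (fun a : ℂ => (MvPolynomial.C a : MvPolynomial σ ℂ))).det =
          (1 + Matrix.diagonal (fun i => MvPolynomial.X (κ' i)) * K'.map (fun a : ℂ => (MvPolynomial.C a : MvPolynomial σ ℂ))).det :=
  Summit.ValiantsHypothesis.ValiantsHypothesis.Theorems.PriceOfContractivity.NormHalvingTwoColour.stub_normHalvingOne_twoColour

/-- **Piece (♦ is closed under products): principal minors of a direct sum.** If every principal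
minor of `K₁` (resp. `K₂`) indexed by an injective `w : Fin (k+1) → Fin Sᵢ` has modulus `≤ B^(k+1)`,
then so does every principal minor of the direct sum `K₁ ⊕ K₂` (reindexed to `Fin (S₁ + S₂)` by
`finSumFinEquiv`): the indexed submatrix is block-diagonal after a permutation, its determinant is the
product of a principal minor of `K₁` and one of `K₂` (an empty block contributing `1 = B^0`), and the
exponents add. [folklore] -/
theorem stub_minorBound_directSum :
    ∀ (S₁ S₂ : ℕ) (B : ℝ) (K₁ : Matrix (Fin S₁) (Fin S₁) ℂ) (K₂ : Matrix (Fin S₂) (Fin S₂) ℂ),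
      (∀ (k : ℕ) (w : Fin (k + 1) → Fin S₁), Function.Injective w →
        ‖(K₁.submatrix w w).det‖ ≤ B ^ (k + 1)) →
      (∀ (k : ℕ) (w : Fin (k + 1) → Fin S₂), Function.Injective w →
        ‖(K₂.submatrix w w).det‖ ≤ B ^ (k + 1)) →
      ∀ (k : ℕ) (w : Fin (k + 1) → Fin (S₁ + S₂)), Function.Injective w →
        ‖((Matrix.reindex finSumFinEquiv finSumFinEquiv (Matrix.fromBlocks K₁ 0 0 K₂)).submatrix w w).det‖ ≤
          B ^ (k + 1) :=
  Summit.ValiantsHypothesis.ValiantsHypothesis.Theorems.PriceOfContractivity.DirectSum.stub_minorBound_directSum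

/-- **Piece (NH is closed under products): block-triangular pencils factorize; norm of a direct sum.**
For a block upper-triangular `K = [[A, Bm], [0, D]]` (reindexed to `Fin (R₁ + R₂)`) with the colouring
`Sum.elim κ₁ κ₂`, the Sylvester pencil `1 + diag (X ∘ κ) · K` is block upper-triangular as well, so its
determinant is the product of the pencil determinants of `A` and `D` (`Matrix.det_fromBlocks_zero₂₁`);
and the operator norm of a direct sum `A ⊕ D` is at most the max of the two norms (orthogonal blocks).
[folklore] -/
theorem stub_pencil_blockTriangular :
    ∀ {σ : Type} (R₁ R₂ : ℕ) (A : Matrix (Fin R₁) (Fin R₁) ℂ) (Bm : Matrix (Fin R₁) (Fin R₂) ℂ)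
      (D : Matrix (Fin R₂) (Fin R₂) ℂ) (κ₁ : Fin R₁ → σ) (κ₂ : Fin R₂ → σ),
      (1 + Matrix.diagonal (fun i => MvPolynomial.X (Sum.elim κ₁ κ₂ (finSumFinEquiv.symm i))) *
          (Matrix.reindex finSumFinEquiv finSumFinEquiv (Matrix.fromBlocks A Bm 0 D)).map
            (fun a : ℂ => (MvPolynomial.C a : MvPolynomial σ ℂ))).det =
        (1 + Matrix.diagonal (fun i => MvPolynomial.X (κ₁ i)) * A.map (fun a : ℂ => (MvPolynomial.C a : MvPolynomial σ ℂ))).det *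
          (1 + Matrix.diagonal (fun i => MvPolynomial.X (κ₂ i)) * D.map (fun a : ℂ => (MvPolynomial.C a : MvPolynomial σ ℂ))).det ∧
      ‖Matrix.toEuclideanCLM (𝕜 := ℂ) (Matrix.reindex finSumFinEquiv finSumFinEquiv (Matrix.fromBlocks A 0 0 D))‖ ≤
        max ‖Matrix.toEuclideanCLM (𝕜 := ℂ) A‖ ‖Matrix.toEuclideanCLM (𝕜 := ℂ) D‖ :=
  Summit.ValiantsHypothesis.ValiantsHypothesis.Theorems.PriceOfContractivity.BlockTriangular.stub_pencil_blockTriangular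

/-! ## §2a″ Registered pieces and partial case (rev 10): ♦ for at most `L + 1` colours

Theorem A″ (this lead, Lines/birth-fewcolours.md): the one-large-class construction (Theorem A′,
landed) extends to ANY colouring with few colour CLASSES (of arbitrary sizes) once (i) the trie is
taken over the whole foreign box of colour contents and (ii) the trie is conjugated by the diagonal
matrix `diag ((2/t)^{|β|})`, which trades the large raw coefficients `p_β` (up to
`C(n,j) 2^{-j} ≈ (3/2)^n`) for tree-edge entries `t/2`: all entries of `K₁` become `≤ 50 · 2^L`,
and principal minors of a matrix with polynomially bounded entries are `≤ (size · bound)^{order}`.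
This settles the family `(n,n,1)` that Lines/birth-lifting2.md §4 had isolated as the frontier of ♦
(no bi-holomorphic similarity is needed for MINOR bounds), and moves the open core of ♦ to
colourings with MANY classes of size `≥ 2` (minimal family: all classes of size `2`) or one large
class plus many singletons (`(n, 1^n)`).  Pieces W2–W5 are independent and provable now; the
partial case `stub_stableLifting_fewColours` is assembled from them. -/

/-- **Piece W2 (rev 10): Schur/row-multilinear expansion of a two-block pencil, any number of
foreign rows.**  For `K = [[A, B], [C, D]]` (blocks `Fin n`, `Fin t`) coloured `x` on the first
block and `c` on the second, `det (1 + diag (X∘κ) K) = Σ_{S ⊆ Fin t} Ê_S · ∏_{i ∈ S} X_{c i}` with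
the bordered determinants `E_S = det [[1 + ξA, ξB_{·S}], [C_{S·}, D_{SS}]] ∈ ℂ[ξ]` and `^` the
substitution `ξ ↦ X_x` (expand the determinant multilinearly in the foreign rows
`e_i + X_{c i} · K_i`; unit rows delete their row and column). [folklore] -/
theorem piece3_schurExpansion :
    ∀ {σ : Type} {n t : ℕ} (x : σ) (c : Fin t → σ) (A : Matrix (Fin n) (Fin n) ℂ)
      (B : Matrix (Fin n) (Fin t) ℂ) (C : Matrix (Fin t) (Fin n) ℂ) (D : Matrix (Fin t) (Fin t) ℂ),
      (1 + Matrix.diagonal (fun i => MvPolynomial.X (Sum.elim (fun _ => x) c i)) *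
          (Matrix.fromBlocks A B C D).map (fun a : ℂ => (MvPolynomial.C a : MvPolynomial σ ℂ))).det =
        ∑ S : Finset (Fin t),
          Polynomial.aeval (MvPolynomial.X x : MvPolynomial σ ℂ)
            (Matrix.fromBlocks
              ((1 : Matrix (Fin n) (Fin n) (Polynomial ℂ)) +
                (Polynomial.X : Polynomial ℂ) • A.map (fun a : ℂ => Polynomial.C a))
              ((Polynomial.X : Polynomial ℂ) •
                (B.submatrix id (fun i : S => (i : Fin t))).map (fun a : ℂ => Polynomial.C a))
              ((C.submatrix (fun i : S => (i : Fin t)) id).map (fun a : ℂ => Polynomial.C a))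
              ((D.submatrix (fun i : S => (i : Fin t)) (fun i : S => (i : Fin t))).map
                (fun a : ℂ => Polynomial.C a))).det *
            ∏ i ∈ S, MvPolynomial.X (c i) :=
  Summit.ValiantsHypothesis.ValiantsHypothesis.Theorems.PriceOfContractivity.FewColours.piece3_schurExpansion

/-- **Piece W3 (rev 10): coefficient bound for margin-2 zero-free polynomials of total degree
`≤ t`.**  If `q(0) = 1`, `deg q ≤ t`, `t ≥ 1` and `q` has no zero on the closed polydisc of radius
`2`, then `|coeff_α q| ≤ 3 · (t/2)^{|α|}`: the slice `s ↦ q(s w)` (`‖w‖_∞ ≤ 2/t`) is a univariate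
polynomial of degree `≤ t` with no zero in `|s| ≤ t` and value `1` at `0`, so
`|q(w)| ≤ (1 + 1/t)^t ≤ e ≤ 3` on the polydisc of radius `2/t`, and Cauchy's estimate on that
torus gives the bound. [folklore] -/
theorem piece3_coeffBound :
    ∀ {ι : Type} [Fintype ι] [DecidableEq ι] (q : MvPolynomial ι ℂ) (t : ℕ), 1 ≤ t →
      q.totalDegree ≤ t → MvPolynomial.eval (0 : ι → ℂ) q = 1 →
      (∀ z : ι → ℂ, (∀ j, ‖z j‖ ≤ 2) → MvPolynomial.eval z q ≠ 0) →
      ∀ α : ι →₀ ℕ, ‖q.coeff α‖ ≤ 3 * ((t : ℝ) / 2) ^ α.degree :=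
  Summit.ValiantsHypothesis.ValiantsHypothesis.Theorems.PriceOfContractivity.FewColours.piece3_coeffBound

/-- **Piece W4 (rev 10): the forest ("trie") determinant identity.**  For a finite forest given by
a parent map `par` (acyclic through the rank `rk`), variables `y`, node weights `e` and the path
monomials `mon` (`mon root = y root`, `mon child = mon parent · y child`), the matrix
`M = N₀ + e rᵀ` (`N₀[v,w] = −1` iff `v = par w`; `r` = indicator of the roots) satisfies
`det (1 + diag(y) M) = 1 + Σ_w e_w mon_w` over any commutative ring (matrix determinant lemma:
`1 + diag(y) N₀` is unipotent and `(1 + diag(y) N₀)⁻¹ diag(y) e` telescopes along the unique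
root paths).  Lemma T of Lines/birth-lifting2.md in abstract form. [folklore] -/
theorem piece3_trie :
    ∀ {A : Type} [CommRing A] {V : Type} [Fintype V] [DecidableEq V] (par : V → Option V) (rk : V → ℕ),
      (∀ v w, par w = some v → rk v < rk w) →
      ∀ (y e mon : V → A), (∀ w, par w = none → mon w = y w) →
        (∀ v w, par w = some v → mon w = mon v * y w) →
        (1 + Matrix.diagonal y *
            Matrix.of (fun v w : V => (if par w = some v then (-1 : A) else 0) +
              e v * (if par w = none then 1 else 0))).det =
          1 + ∑ w, e w * mon w :=
  Summit.ValiantsHypothesis.ValiantsHypothesis.Theorems.PriceOfContractivity.FewColours.piece3_trie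

/-- **Piece W5 (rev 10): assembly of the rescaled companion block with a forest of coefficient
functions** (generalizes the landed `OneLargeClass.piece_d_assembly` from the 3-node trie to an
arbitrary forest; the forest identity W4 is the first hypothesis, verbatim).  Given `a ∈ ℂ[ξ]`
(`a(0) = 1`, `deg ≤ N+1`, `|a_{j+1}| ≤ Ma r^j`) and a family `E_w ∈ ℂ[ξ]` (`deg ≤ N+1`,
`|E_{w,j}| ≤ Me r^j`) indexed by the forest, the block matrix `K₁ = [[−r Sᵀ, B′], [C′, D′]]`
(`S` the companion/backward-shift matrix of `a` in the basis `(rξ)^k/a`, `B′ = e₀ ⊗ τ·1_roots`,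
`C′` the rescaled shifted coefficient rows, `D′ = −τ N₀ + τ E(0) 1_rootsᵀ`) has all entries of
modulus `≤ r + Ma + τ(1 + Me) + Me(r + Ma)` and pencil determinant
`â + Σ_w Ê_w · τ^{rk w} · mon_w` (pointwise Schur complement, the landed shift identity
`OneLargeClass.piece_d_shift`, W4 with `y_w = τ X_{col w}`, and `schur_eq_of_eval_eq`). [folklore] -/
theorem piece3_assembly :
    (∀ {A : Type} [CommRing A] {V : Type} [Fintype V] [DecidableEq V] (par : V → Option V) (rk : V → ℕ),
      (∀ v w, par w = some v → rk v < rk w) →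
      ∀ (y e mon : V → A), (∀ w, par w = none → mon w = y w) →
        (∀ v w, par w = some v → mon w = mon v * y w) →
        (1 + Matrix.diagonal y *
            Matrix.of (fun v w : V => (if par w = some v then (-1 : A) else 0) +
              e v * (if par w = none then 1 else 0))).det =
          1 + ∑ w, e w * mon w) →
    ∀ {σ : Type} (x : σ) {V : Type} [Fintype V] [DecidableEq V] (par : V → Option V) (rk : V → ℕ)
      (col : V → σ) (mon : V → MvPolynomial σ ℂ),
      (∀ w, par w = none → rk w = 1) → (∀ v w, par w = some v → rk w = rk v + 1) →
      (∀ w, par w = none → mon w = MvPolynomial.X (col w)) →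
      (∀ v w, par w = some v → mon w = mon v * MvPolynomial.X (col w)) →
      ∀ (N : ℕ) (r τ Ma Me : ℝ) (a : Polynomial ℂ) (E : V → Polynomial ℂ),
        0 < r → 1 ≤ τ → 0 ≤ Ma → 0 ≤ Me → a.coeff 0 = 1 → a.natDegree ≤ N + 1 →
        (∀ w, (E w).natDegree ≤ N + 1) →
        (∀ j : ℕ, ‖a.coeff (j + 1)‖ ≤ Ma * r ^ j) →
        (∀ (w : V) (j : ℕ), ‖(E w).coeff j‖ ≤ Me * r ^ j) →
        ∃ K₁ : Matrix (Fin (N + 1) ⊕ V) (Fin (N + 1) ⊕ V) ℂ,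
          (∀ i j, ‖K₁ i j‖ ≤ r + Ma + τ * (1 + Me) + Me * (r + Ma)) ∧
          (1 + Matrix.diagonal (fun i => MvPolynomial.X (Sum.elim (fun _ => x) col i)) *
              K₁.map (fun a : ℂ => (MvPolynomial.C a : MvPolynomial σ ℂ))).det =
            Polynomial.aeval (MvPolynomial.X x : MvPolynomial σ ℂ) a +
              ∑ w, Polynomial.aeval (MvPolynomial.X x : MvPolynomial σ ℂ) (E w) *
                (MvPolynomial.C ((τ : ℂ) ^ rk w) * mon w) :=
  Summit.ValiantsHypothesis.ValiantsHypothesis.Theorems.PriceOfContractivity.FewColours.piece3_assembly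

/-- **Piece W6a (rev 11): the coefficient family of the content regrouping, with all bounds.**  For
the two-block pencil of `[[A,B],[C,D]]` (colour `x` on `Fin n`, `c` on `Fin t`, `c` factoring through an
injective enumeration `g : Fin f → σ` of foreign colours, all `≠ x`) whose determinant `P` is zero-free
on the closed radius-2 polydisc: `P = â + Σ_{β ≠ 0} p̂_β · ∏_j X_{g j}^{β j}` over the box
`β : Fin f → Fin (t+1)`, with `a = E_∅` (`a(0) = 1`, `deg ≤ n`, `|a_m| ≤ 3 ((n+1)/2)^m`) and
`p_β = Σ_{content S = β} E_S` (`deg ≤ n + t`, `|p_{β,m}| ≤ 9 (t/2)^{|β|} ((n+1)/2)^m`) — W2, W3 applied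
to `P(ξ,·)/a(ξ)` (total degree `≤ t`, zero-free, value 1 at 0), `|a| ≤ 3` on `|ξ| ≤ 2/(n+1)`
(eigenvalues `≤ 1/2`), and Cauchy on that disc (`piece_c_cauchy`). [folklore] -/
theorem piece3_contentBounds :
    ∀ {σ : Type} (x : σ) {n t f : ℕ} (c : Fin t → σ) (g : Fin f → σ) (idx : Fin t → Fin f),
      (∀ i, g (idx i) = c i) → (∀ j, g j ≠ x) → Function.Injective g →
      ∀ (A : Matrix (Fin n) (Fin n) ℂ) (B : Matrix (Fin n) (Fin t) ℂ) (C : Matrix (Fin t) (Fin n) ℂ)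
        (D : Matrix (Fin t) (Fin t) ℂ),
      (∀ z : σ → ℂ, (∀ j, ‖z j‖ ≤ 2) →
        MvPolynomial.eval z (1 + Matrix.diagonal (fun i => MvPolynomial.X (Sum.elim (fun _ => x) c i)) *
          (Matrix.fromBlocks A B C D).map (fun a : ℂ => (MvPolynomial.C a : MvPolynomial σ ℂ))).det ≠ 0) →
      ∃ (a : Polynomial ℂ) (p : {β : Fin f → Fin (t + 1) // β ≠ 0} → Polynomial ℂ),
        a.coeff 0 = 1 ∧ a.natDegree ≤ n ∧ (∀ β, (p β).natDegree ≤ n + t) ∧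
        (∀ m : ℕ, ‖a.coeff m‖ ≤ 3 * (((n : ℝ) + 1) / 2) ^ m) ∧
        (∀ (β : {β : Fin f → Fin (t + 1) // β ≠ 0}) (m : ℕ),
          ‖(p β).coeff m‖ ≤ 9 * ((t : ℝ) / 2) ^ (∑ j, (β.1 j : ℕ)) * (((n : ℝ) + 1) / 2) ^ m) ∧
        (1 + Matrix.diagonal (fun i => MvPolynomial.X (Sum.elim (fun _ => x) c i)) *
            (Matrix.fromBlocks A B C D).map (fun a : ℂ => (MvPolynomial.C a : MvPolynomial σ ℂ))).det =
          Polynomial.aeval (MvPolynomial.X x : MvPolynomial σ ℂ) a +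
            ∑ β : {β : Fin f → Fin (t + 1) // β ≠ 0},
              Polynomial.aeval (MvPolynomial.X x : MvPolynomial σ ℂ) (p β) *
                ∏ j : Fin f, (MvPolynomial.X (g j) : MvPolynomial σ ℂ) ^ (β.1 j : ℕ) :=
  Summit.ValiantsHypothesis.ValiantsHypothesis.Theorems.PriceOfContractivity.FewColours.piece3_contentBounds

/-- **Partial case (♦ with at most `L + 1` colours; rev 10), unconditional — Theorem A″ of
Lines/birth-fewcolours.md.**  Peel the colour `x` of row `0` (Schur complement, W2), bound the
coefficient polynomials `p_β = Σ_{content S = β} E_S` by `|p_β(ξ)| ≤ 9 (t/2)^{|β|}` on the small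
disc `|ξ| ≤ 2/(n+1)` (W3 applied to `P(ξ, ·)/a(ξ)`, and `|a| ≤ 3` there), hence
`|p_{β,m}| ≤ 9 (t/2)^{|β|} ((n+1)/2)^m` (Cauchy), realize `a` by the rescaled companion block and
the RESCALED coefficients `Ẽ_β = (2/t)^{|β|} p_β` by the box forest on
`{β : Fin f → Fin (t+1), β ≠ 0}` (W4, W5 with `τ = max 1 (t/2)`): size `R₁ ≤ R + (t+1)^L`, all
entries `≤ 50 · 2^L`, so every `(k+1)`-minor is `≤ (k+1)! (2^(L+6))^(k+1) ≤ (2^((L+3)^3))^(k+1)`;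
`d = 3`.  Covers every colouring with a bounded number of colour classes of ARBITRARY sizes, in
particular `(n,n,1)` and `(n,n,n)`. -/
theorem stub_stableLifting_fewColours :
    ∃ d : ℕ, ∀ (L R : ℕ) {σ : Type} (K₀ : Matrix (Fin R) (Fin R) ℂ) (κ : Fin R → σ),
      (∃ s : Finset σ, s.card ≤ L + 1 ∧ ∀ i, κ i ∈ s) →
      R ≤ 2 ^ L →
      (∀ z : σ → ℂ, (∀ j, ‖z j‖ ≤ 2) → MvPolynomial.eval z (1 + Matrix.diagonal (fun i => MvPolynomial.X (κ i)) * K₀.map (fun a : ℂ => (MvPolynomial.C a : MvPolynomial σ ℂ))).det ≠ 0) →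
      ∃ R₁ ≤ 2 ^ ((L + d) ^ d), ∃ (K₁ : Matrix (Fin R₁) (Fin R₁) ℂ) (κ₁ : Fin R₁ → σ),
        (∀ (k : ℕ) (w : Fin (k + 1) → Fin R₁), Function.Injective w →
          ‖(K₁.submatrix w w).det‖ ≤ ((2 : ℝ) ^ ((L + d) ^ d)) ^ (k + 1)) ∧
        (1 + Matrix.diagonal (fun i => MvPolynomial.X (κ i)) * K₀.map (fun a : ℂ => (MvPolynomial.C a : MvPolynomial σ ℂ))).det =
          (1 + Matrix.diagonal (fun i => MvPolynomial.X (κ₁ i)) * K₁.map (fun a : ℂ => (MvPolynomial.C a : MvPolynomial σ ℂ))).det :=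
  Summit.ValiantsHypothesis.ValiantsHypothesis.Theorems.PriceOfContractivity.FewColours.stub_stableLifting_fewColours

/-! ## §2a‴ Registered conditional partial case of the CRUX (rev 13): polylogarithmically many variables

With Theorem A″ the lifting stub ♦ is PROVED for every colouring with at most `L + 1` colours, and in
the composition `L = 2 log₂ (m + N) + 2`; so for inputs with `N ≤ 2 log₂ (m + N) + 3` variables the whole
line closes modulo NH₁ alone.  `stub_priceOfContractivity_fewVars` records exactly this: NH₁ (spelled
out verbatim, first hypothesis) implies the crux restricted to `N ≤ 2 log₂ (m + N) + 3` (i.e. `N =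
O(log m)`), with the same quasi-polynomial size law.  Provable now by re-running §2c–§6 of this file
with `stub_stableLifting_fewColours` in place of ♦ (all other inputs are landed). -/

/-- **Conditional partial case of the crux (rev 13): `N ≤ 2 log₂(m+N) + 3` variables, from NH₁ alone.**
The first hypothesis is `Sig.stub_normHalvingOne` verbatim; the conclusion is `PriceOfContractivity`
with the extra hypothesis `N ≤ 2 * Nat.log 2 (m + N) + 3`.  Proof = this skeleton's composition with
♦ supplied by the landed `stub_stableLifting_fewColours` (the normal-form colouring uses `≤ #σ ≤ N ≤ L+1`
colours for `L = 2 log₂(m+N) + 2`), the landed cycle-mean bound, balancing, rescaling glue and the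
bit-budget induction. -/
theorem stub_priceOfContractivity_fewVars :
    (∃ c : ℕ, ∀ (n R : ℕ) {σ : Type} [Fintype σ] (K : Matrix (Fin R) (Fin R) ℂ) (κ : Fin R → σ),
      R ≤ 2 ^ ((Nat.log 2 n + c + 2) ^ (c + 2)) →
      Fintype.card σ ≤ n →
      (1 + Matrix.diagonal (fun i => MvPolynomial.X (κ i)) * K.map (fun a : ℂ => (MvPolynomial.C a : MvPolynomial σ ℂ))).det.totalDegree ≤ n →
      ‖Matrix.toEuclideanCLM (𝕜 := ℂ) K‖ ≤ 2 →
      (∀ z : σ → ℂ, (∀ j, ‖z j‖ ≤ 2) → MvPolynomial.eval z (1 + Matrix.diagonal (fun i => MvPolynomial.X (κ i)) * K.map (fun a : ℂ => (MvPolynomial.C a : MvPolynomial σ ℂ))).det ≠ 0) →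
      ∃ R' ≤ 2 ^ ((Nat.log 2 n + c) ^ c) * R, ∃ (K' : Matrix (Fin R') (Fin R') ℂ) (κ' : Fin R' → σ),
        ‖Matrix.toEuclideanCLM (𝕜 := ℂ) K'‖ ≤ 1 ∧
        (1 + Matrix.diagonal (fun i => MvPolynomial.X (κ i)) * K.map (fun a : ℂ => (MvPolynomial.C a : MvPolynomial σ ℂ))).det =
          (1 + Matrix.diagonal (fun i => MvPolynomial.X (κ' i)) * K'.map (fun a : ℂ => (MvPolynomial.C a : MvPolynomial σ ℂ))).det) →
    ∃ d : ℕ, ∀ (N m : ℕ) {σ : Type} [Fintype σ] (p : MvPolynomial σ ℂ), Fintype.card σ ≤ N →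
      N ≤ 2 * Nat.log 2 (m + N) + 3 →
      Literature.Computability.AlgebraicComplexity.HasDetRepr p m →
      (∀ z : σ → ℂ, (∀ j, ‖z j‖ ≤ 2) → MvPolynomial.eval z p ≠ 0) →
      ∃ R ≤ 2 ^ ((Nat.log 2 (m + N) + d) ^ d), ∃ (K : Matrix (Fin R) (Fin R) ℂ) (κ : Fin R → σ),
        ‖Matrix.toEuclideanCLM (𝕜 := ℂ) K‖ ≤ 1 ∧
        p = MvPolynomial.C (MvPolynomial.eval 0 p) *
          (1 + Matrix.diagonal (fun i => MvPolynomial.X (κ i)) * K.map (fun a : ℂ => (MvPolynomial.C a : MvPolynomial σ ℂ))).det :=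
  Summit.ValiantsHypothesis.ValiantsHypothesis.Theorems.PriceOfContractivity.FewVars.stub_priceOfContractivity_fewVars

/-- **Unconditional partial case of the crux up to a norm budget (rev 15): `N ≤ 2 log₂(m+N) + 3` variables.**
For such inputs the Sylvester normal form uses `≤ L + 1` colours (`L = 2 log₂(m+N) + 2`), so Theorem A″ and the
landed cycle-mean bound + balancing (`FewVars.balancedBudget_fewColours`) give a realization of quasi-polynomial
SIZE and quasi-polynomial NORM BUDGET `‖K‖ ≤ 2 ^ ((log₂(m+N) + d)^d)` — the crux's conclusion with `≤ 1` replaced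
by the budget; what remains for the crux in this regime is exactly NH₁ (`stub_priceOfContractivity_fewVars`). -/
theorem stub_budgetOfContractivity_fewVars :
    ∃ d : ℕ, ∀ (N m : ℕ) {σ : Type} [Fintype σ] (p : MvPolynomial σ ℂ), Fintype.card σ ≤ N →
      N ≤ 2 * Nat.log 2 (m + N) + 3 →
      Literature.Computability.AlgebraicComplexity.HasDetRepr p m →
      (∀ z : σ → ℂ, (∀ j, ‖z j‖ ≤ 2) → MvPolynomial.eval z p ≠ 0) →
      ∃ R ≤ 2 ^ ((Nat.log 2 (m + N) + d) ^ d), ∃ (K : Matrix (Fin R) (Fin R) ℂ) (κ : Fin R → σ),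
        ‖Matrix.toEuclideanCLM (𝕜 := ℂ) K‖ ≤ (2 : ℝ) ^ ((Nat.log 2 (m + N) + d) ^ d) ∧
        p = MvPolynomial.C (MvPolynomial.eval 0 p) *
          (1 + Matrix.diagonal (fun i => MvPolynomial.X (κ i)) * K.map (fun a : ℂ => (MvPolynomial.C a : MvPolynomial σ ℂ))).det :=
  Summit.ValiantsHypothesis.ValiantsHypothesis.Theorems.PriceOfContractivity.FewVarsBudget.stub_budgetOfContractivity_fewVars

/-! ## §2a⁗ Registered pieces and partial case (rev 17, lead c4): NH₁ for ONE colour class plus ONE singleton,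
UNCONDITIONAL — the weighted model-space colligation

First unconditional case of NH₁ with a genuine two-variable interaction (profile `(n, 1)`: all rows but
at most one carry one colour `x`; Doyle's `2S + F ≤ 3` regime with `S = F = 1`).  Construction (this lead,
NOTES.md §M1): write the pencil determinant as `a(ξ) + y·b(ξ)` (`a = det (1 + ξA)`, `b` a bordered
determinant, `|b| ≤ |a|/2` on `|ξ| ≤ 2` by Vieta), put `φ = b/a` and realize `φ` on the model space
`W⁺ = {u/a : deg u ≤ N+1}` normed by `‖g‖² = Σ_k |ĝ(k)|² 2^k` (Taylor coefficients at `0`; the `H²` norm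
of `g(√2·)`): the backward shift `S` satisfies the STEIN IDENTITY `‖g‖² = |g(0)|² + 2 ‖Sg‖²`, Cauchy's
estimate gives `‖φ‖² ≤ Σ (1/4)·4^{-k}·2^k = 1/2`, and the colligation
`K' = [[-T S T⁻¹, √2·T(Sφ)], [-(1/√2) ev₀ T⁻¹, φ(0)]]` (`T*T` = Gram matrix of `W`) is a CONTRACTION
(`‖K'(v,u)‖² = ½‖T⁻¹v ⊕ 0 − √2 u φ‖²_{W⁺} ≤ ½(‖v‖ + |u|)² ≤ ‖v‖² + |u|²`) whose `x`-block has
`det (1 + ξ(−TST⁻¹)) = a(ξ)` EXACTLY and whose Schur complement is `φ(ξ)` (landed shift identity), so its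
pencil determinant is `a + y b`.  Same size up to `+2`, norm `≤ 1`, no cited facts.  Four pieces:
(N1) Cauchy → Taylor-coefficient bound for `b/a`; (N2) the Gram matrix: positive definite, `tsum` formula,
Stein identity; (N3) the contraction (finite-dimensional linear algebra); (N4) assembly into the
registered shape with (N1)–(N3) as verbatim hypotheses. -/

/-- **Piece N1 (Cauchy's estimate for the Taylor coefficients of `b/a`).**  If `a(0) = 1`, `a ≠ 0` on
`|ξ| ≤ 2` and `|b(ξ)| ≤ M |a(ξ)|` there, then the `k`-th coefficient of the power series `b · a⁻¹`
(the Taylor series of `b/a` at `0`) has modulus `≤ M / 2^k`. [folklore: Cauchy's integral formula on the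
circle of radius 2 + identification of the Cauchy power series of `b/a` with `b · a⁻¹` through the
recursion `a ⋆ c = b`] -/
theorem stubN_cauchyCoeff :
    ∀ (a b : Polynomial ℂ) (M : ℝ), a.coeff 0 = 1 →
      (∀ ξ : ℂ, ‖ξ‖ ≤ 2 → a.eval ξ ≠ 0) →
      (∀ ξ : ℂ, ‖ξ‖ ≤ 2 → ‖b.eval ξ‖ ≤ M * ‖a.eval ξ‖) →
      ∀ k : ℕ, ‖PowerSeries.coeff k ((b : PowerSeries ℂ) * (a : PowerSeries ℂ)⁻¹)‖ ≤ M / 2 ^ k :=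
  Summit.ValiantsHypothesis.ValiantsHypothesis.Theorems.PriceOfContractivity.NormHalvingModelSpace.stubN_cauchyCoeff

/-- **Piece N2 (the Gram matrix of the weighted model space; Stein identity).**  For `a(0) = 1`,
`deg a ≤ N + 1` and geometrically decaying coefficients of `a⁻¹` (`≤ C/2^m`), the Hermitian matrix
`Gp_{ij} = Σ_k conj(f̂ᵢ(k)) f̂ⱼ(k) 2^k` (`f̂ⱼ` = coefficients of `ξ^j · a⁻¹`, `i, j ≤ N + 1`) is positive
definite, represents `v ↦ Σ_k |ĝ(k)|² 2^k` for `g = (Σ vⱼ ξ^j) · a⁻¹` (summable), and satisfies the Stein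
identity `v* Gp v = 2 (Ŝv)* G (Ŝv) + |v₀|²` with `G` the leading `(N+1) × (N+1)` block and
`(Ŝv)_k = v_{k+1} − v₀ a_{k+1}` the coefficients of the backward shift `(g − g(0))/ξ`. [folklore] -/
theorem stubN_gramStein :
    ∀ (N : ℕ) (a : Polynomial ℂ), a.coeff 0 = 1 → a.natDegree ≤ N + 1 →
      (∃ C : ℝ, ∀ m : ℕ, ‖PowerSeries.coeff m ((a : PowerSeries ℂ)⁻¹)‖ ≤ C / 2 ^ m) →
      ∃ Gp : Matrix (Fin (N + 2)) (Fin (N + 2)) ℂ, Gp.IsHermitian ∧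
        (∀ v : Fin (N + 2) → ℂ, v ≠ 0 → 0 < RCLike.re (star v ⬝ᵥ (Gp *ᵥ v))) ∧
        (∀ v : Fin (N + 2) → ℂ,
          Summable (fun k : ℕ => ‖PowerSeries.coeff k
              (((∑ j : Fin (N + 2), Polynomial.monomial (j : ℕ) (v j) : Polynomial ℂ) : PowerSeries ℂ) *
                (a : PowerSeries ℂ)⁻¹)‖ ^ 2 * 2 ^ k) ∧
          star v ⬝ᵥ (Gp *ᵥ v) = ((∑' k : ℕ, ‖PowerSeries.coeff k
              (((∑ j : Fin (N + 2), Polynomial.monomial (j : ℕ) (v j) : Polynomial ℂ) : PowerSeries ℂ) *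
                (a : PowerSeries ℂ)⁻¹)‖ ^ 2 * 2 ^ k : ℝ) : ℂ)) ∧
        (∀ v : Fin (N + 2) → ℂ,
          star v ⬝ᵥ (Gp *ᵥ v) =
            2 * (star (fun k : Fin (N + 1) => v k.succ - v 0 * a.coeff ((k : ℕ) + 1)) ⬝ᵥ
              ((Gp.submatrix Fin.castSucc Fin.castSucc) *ᵥ
                (fun k : Fin (N + 1) => v k.succ - v 0 * a.coeff ((k : ℕ) + 1)))) +
            ((‖v 0‖ ^ 2 : ℝ) : ℂ)) :=
  Summit.ValiantsHypothesis.ValiantsHypothesis.Theorems.PriceOfContractivity.NormHalvingModelSpace.stubN_gramStein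

/-- **Piece N3 (the contraction).**  If `Gp` is positive definite and satisfies the Stein identity of
N2, and `φ* Gp φ ≤ 1/2`, then for `T` a square root of the leading block `G` (`T* T = G`, e.g.
`T = G^{1/2}`) the colligation `[[−T S T⁻¹, √2 T (Ŝφ)], [−(1/√2) e₀ᵀ T⁻¹, φ₀]]` (`S` the companion /
backward-shift matrix of `a`) has Euclidean operator norm `≤ 1`:
`‖K'(v,u)‖² = ‖T Ŝ ĝ‖² + |ĝ₀|²/2 = ½ ĝ* Gp ĝ` for `ĝ = (T⁻¹v, 0) − √2 u φ`, and
`√(ĝ* Gp ĝ) ≤ ‖v‖ + √2 |u| √(φ* Gp φ) ≤ ‖v‖ + |u|`. [folklore] -/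
theorem stubN_contraction :
    ∀ (N : ℕ) (a : Polynomial ℂ) (Gp : Matrix (Fin (N + 2)) (Fin (N + 2)) ℂ) (φ : Fin (N + 2) → ℂ),
      Gp.IsHermitian → (∀ v : Fin (N + 2) → ℂ, v ≠ 0 → 0 < RCLike.re (star v ⬝ᵥ (Gp *ᵥ v))) →
      (∀ v : Fin (N + 2) → ℂ,
          star v ⬝ᵥ (Gp *ᵥ v) =
            2 * (star (fun k : Fin (N + 1) => v k.succ - v 0 * a.coeff ((k : ℕ) + 1)) ⬝ᵥ
              ((Gp.submatrix Fin.castSucc Fin.castSucc) *ᵥ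
                (fun k : Fin (N + 1) => v k.succ - v 0 * a.coeff ((k : ℕ) + 1)))) +
            ((‖v 0‖ ^ 2 : ℝ) : ℂ)) →
      RCLike.re (star φ ⬝ᵥ (Gp *ᵥ φ)) ≤ 1 / 2 →
      ∃ (T : Matrix (Fin (N + 1)) (Fin (N + 1)) ℂ) (K' : Matrix (Fin (N + 1 + 1)) (Fin (N + 1 + 1)) ℂ),
        IsUnit T.det ∧
        K' = Matrix.reindex finSumFinEquiv finSumFinEquiv
            (Matrix.fromBlocks
              (-(T * Matrix.of (fun i j : Fin (N + 1) =>
                  if (j : ℕ) = 0 then -a.coeff ((i : ℕ) + 1) else if (i : ℕ) + 1 = (j : ℕ) then (1 : ℂ) else 0) * T⁻¹))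
              (Matrix.replicateCol (Fin 1)
                ((Real.sqrt 2 : ℂ) • (T *ᵥ (fun k : Fin (N + 1) => φ k.succ - φ 0 * a.coeff ((k : ℕ) + 1)))))
              (Matrix.replicateRow (Fin 1) (-(((Real.sqrt 2 : ℝ) : ℂ)⁻¹ • (T⁻¹ 0))))
              (φ 0 • (1 : Matrix (Fin 1) (Fin 1) ℂ))) ∧
        ‖Matrix.toEuclideanCLM (𝕜 := ℂ) K'‖ ≤ 1 :=
  Summit.ValiantsHypothesis.ValiantsHypothesis.Theorems.PriceOfContractivity.NormHalvingModelSpace.stubN_contraction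

/-- **Piece N4 (assembly of NH₁ for one colour class + one singleton).**  Hypotheses: the statements
of N1, N2, N3 verbatim.  Conclusion: the registered shape of `stub_normHalvingOne` with the extra
profile hypothesis `∃ x, Nat.card {i // κ i ≠ x} ≤ 1`, with `c = 2` (size `R' = R + 2 ≤ 16 R`).
Route: block indexing (`x`-rows first, `t ≤ 1` foreign rows; `t = 0` is the landed single-colour
case `SingleColour.stub_sameSize_singleColour`); Schur expansion `P = â + b̂ X_c` (landed
`OneLargeClass.piece_a_schurExpansion`, `deg b ≤ n + 2`); Vieta `|b| ≤ |a|/2` on `|ξ| ≤ 2` (landed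
`bnd_norm_le_of_linear_ne_zero`); compactness bound for `1/a`; N1 twice (for `b` with `M = 1/2`, for
`1` with `M = C`); N2 at `N = n + 1`; `φ = ` coefficient vector of `b`, `φ* Gp φ ≤ Σ ¼·4^{-k}·2^k = ½`;
N3; the pencil identity pointwise (landed `OneLargeClass.piece_d_shift`: `det (1 − ξS) = a(ξ)` and the
shift identity, invariance under `T`) and `schur_eq_of_eval_eq`; reindexing. [folklore assembly] -/
theorem stubN_assembly :
    (∀ (a b : Polynomial ℂ) (M : ℝ), a.coeff 0 = 1 →
      (∀ ξ : ℂ, ‖ξ‖ ≤ 2 → a.eval ξ ≠ 0) →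
      (∀ ξ : ℂ, ‖ξ‖ ≤ 2 → ‖b.eval ξ‖ ≤ M * ‖a.eval ξ‖) →
      ∀ k : ℕ, ‖PowerSeries.coeff k ((b : PowerSeries ℂ) * (a : PowerSeries ℂ)⁻¹)‖ ≤ M / 2 ^ k) →
    (∀ (N : ℕ) (a : Polynomial ℂ), a.coeff 0 = 1 → a.natDegree ≤ N + 1 →
      (∃ C : ℝ, ∀ m : ℕ, ‖PowerSeries.coeff m ((a : PowerSeries ℂ)⁻¹)‖ ≤ C / 2 ^ m) →
      ∃ Gp : Matrix (Fin (N + 2)) (Fin (N + 2)) ℂ, Gp.IsHermitian ∧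
        (∀ v : Fin (N + 2) → ℂ, v ≠ 0 → 0 < RCLike.re (star v ⬝ᵥ (Gp *ᵥ v))) ∧
        (∀ v : Fin (N + 2) → ℂ,
          Summable (fun k : ℕ => ‖PowerSeries.coeff k
              (((∑ j : Fin (N + 2), Polynomial.monomial (j : ℕ) (v j) : Polynomial ℂ) : PowerSeries ℂ) *
                (a : PowerSeries ℂ)⁻¹)‖ ^ 2 * 2 ^ k) ∧
          star v ⬝ᵥ (Gp *ᵥ v) = ((∑' k : ℕ, ‖PowerSeries.coeff k
              (((∑ j : Fin (N + 2), Polynomial.monomial (j : ℕ) (v j) : Polynomial ℂ) : PowerSeries ℂ) *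
                (a : PowerSeries ℂ)⁻¹)‖ ^ 2 * 2 ^ k : ℝ) : ℂ)) ∧
        (∀ v : Fin (N + 2) → ℂ,
          star v ⬝ᵥ (Gp *ᵥ v) =
            2 * (star (fun k : Fin (N + 1) => v k.succ - v 0 * a.coeff ((k : ℕ) + 1)) ⬝ᵥ
              ((Gp.submatrix Fin.castSucc Fin.castSucc) *ᵥ
                (fun k : Fin (N + 1) => v k.succ - v 0 * a.coeff ((k : ℕ) + 1)))) +
            ((‖v 0‖ ^ 2 : ℝ) : ℂ))) →
    (∀ (N : ℕ) (a : Polynomial ℂ) (Gp : Matrix (Fin (N + 2)) (Fin (N + 2)) ℂ) (φ : Fin (N + 2) → ℂ),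
      Gp.IsHermitian → (∀ v : Fin (N + 2) → ℂ, v ≠ 0 → 0 < RCLike.re (star v ⬝ᵥ (Gp *ᵥ v))) →
      (∀ v : Fin (N + 2) → ℂ,
          star v ⬝ᵥ (Gp *ᵥ v) =
            2 * (star (fun k : Fin (N + 1) => v k.succ - v 0 * a.coeff ((k : ℕ) + 1)) ⬝ᵥ
              ((Gp.submatrix Fin.castSucc Fin.castSucc) *ᵥ
                (fun k : Fin (N + 1) => v k.succ - v 0 * a.coeff ((k : ℕ) + 1)))) +
            ((‖v 0‖ ^ 2 : ℝ) : ℂ)) →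
      RCLike.re (star φ ⬝ᵥ (Gp *ᵥ φ)) ≤ 1 / 2 →
      ∃ (T : Matrix (Fin (N + 1)) (Fin (N + 1)) ℂ) (K' : Matrix (Fin (N + 1 + 1)) (Fin (N + 1 + 1)) ℂ),
        IsUnit T.det ∧
        K' = Matrix.reindex finSumFinEquiv finSumFinEquiv
            (Matrix.fromBlocks
              (-(T * Matrix.of (fun i j : Fin (N + 1) =>
                  if (j : ℕ) = 0 then -a.coeff ((i : ℕ) + 1) else if (i : ℕ) + 1 = (j : ℕ) then (1 : ℂ) else 0) * T⁻¹))
              (Matrix.replicateCol (Fin 1)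
                ((Real.sqrt 2 : ℂ) • (T *ᵥ (fun k : Fin (N + 1) => φ k.succ - φ 0 * a.coeff ((k : ℕ) + 1)))))
              (Matrix.replicateRow (Fin 1) (-(((Real.sqrt 2 : ℝ) : ℂ)⁻¹ • (T⁻¹ 0))))
              (φ 0 • (1 : Matrix (Fin 1) (Fin 1) ℂ))) ∧
        ‖Matrix.toEuclideanCLM (𝕜 := ℂ) K'‖ ≤ 1) →
    ∃ c : ℕ, ∀ (n R : ℕ) {σ : Type} [Fintype σ] (K : Matrix (Fin R) (Fin R) ℂ) (κ : Fin R → σ),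
      (∃ x : σ, Nat.card {i : Fin R // κ i ≠ x} ≤ 1) →
      R ≤ 2 ^ ((Nat.log 2 n + c + 2) ^ (c + 2)) →
      Fintype.card σ ≤ n →
      (1 + Matrix.diagonal (fun i => MvPolynomial.X (κ i)) * K.map (fun a : ℂ => (MvPolynomial.C a : MvPolynomial σ ℂ))).det.totalDegree ≤ n →
      ‖Matrix.toEuclideanCLM (𝕜 := ℂ) K‖ ≤ 2 →
      (∀ z : σ → ℂ, (∀ j, ‖z j‖ ≤ 2) → MvPolynomial.eval z (1 + Matrix.diagonal (fun i => MvPolynomial.X (κ i)) * K.map (fun a : ℂ => (MvPolynomial.C a : MvPolynomial σ ℂ))).det ≠ 0) →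
      ∃ R' ≤ 2 ^ ((Nat.log 2 n + c) ^ c) * R, ∃ (K' : Matrix (Fin R') (Fin R') ℂ) (κ' : Fin R' → σ),
        ‖Matrix.toEuclideanCLM (𝕜 := ℂ) K'‖ ≤ 1 ∧
        (1 + Matrix.diagonal (fun i => MvPolynomial.X (κ i)) * K.map (fun a : ℂ => (MvPolynomial.C a : MvPolynomial σ ℂ))).det =
          (1 + Matrix.diagonal (fun i => MvPolynomial.X (κ' i)) * K'.map (fun a : ℂ => (MvPolynomial.C a : MvPolynomial σ ℂ))).det :=
  Summit.ValiantsHypothesis.ValiantsHypothesis.Theorems.PriceOfContractivity.NormHalvingModelSpace.stubN_assembly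

/-- **Registered partial case (rev 17): NH₁ for one colour class plus at most one further row,
UNCONDITIONAL** (`c = 2`; same shape as `stub_normHalvingOne` plus the profile hypothesis
`∃ x, Nat.card {i // κ i ≠ x} ≤ 1`).  Closed by `stubN_assembly stubN_cauchyCoeff stubN_gramStein
stubN_contraction` once the four pieces land. -/
theorem stub_normHalvingOne_oneClassOneSingleton :
    ∃ c : ℕ, ∀ (n R : ℕ) {σ : Type} [Fintype σ] (K : Matrix (Fin R) (Fin R) ℂ) (κ : Fin R → σ),
      (∃ x : σ, Nat.card {i : Fin R // κ i ≠ x} ≤ 1) →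
      R ≤ 2 ^ ((Nat.log 2 n + c + 2) ^ (c + 2)) →
      Fintype.card σ ≤ n →
      (1 + Matrix.diagonal (fun i => MvPolynomial.X (κ i)) * K.map (fun a : ℂ => (MvPolynomial.C a : MvPolynomial σ ℂ))).det.totalDegree ≤ n →
      ‖Matrix.toEuclideanCLM (𝕜 := ℂ) K‖ ≤ 2 →
      (∀ z : σ → ℂ, (∀ j, ‖z j‖ ≤ 2) → MvPolynomial.eval z (1 + Matrix.diagonal (fun i => MvPolynomial.X (κ i)) * K.map (fun a : ℂ => (MvPolynomial.C a : MvPolynomial σ ℂ))).det ≠ 0) →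
      ∃ R' ≤ 2 ^ ((Nat.log 2 n + c) ^ c) * R, ∃ (K' : Matrix (Fin R') (Fin R') ℂ) (κ' : Fin R' → σ),
        ‖Matrix.toEuclideanCLM (𝕜 := ℂ) K'‖ ≤ 1 ∧
        (1 + Matrix.diagonal (fun i => MvPolynomial.X (κ i)) * K.map (fun a : ℂ => (MvPolynomial.C a : MvPolynomial σ ℂ))).det =
          (1 + Matrix.diagonal (fun i => MvPolynomial.X (κ' i)) * K'.map (fun a : ℂ => (MvPolynomial.C a : MvPolynomial σ ℂ))).det :=
  Summit.ValiantsHypothesis.ValiantsHypothesis.Theorems.PriceOfContractivity.NormHalvingModelSpace.stub_normHalvingOne_oneClassOneSingleton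

/-! ## §2b Partial cases registered in rev 3 — ALL LANDED (wave 1); cited from the tree

Each `stub_sameSize_*` below is the common special case of BOTH composing stubs on a class of
pencils where the sharp answer holds — a re-realization of the SAME size with `‖K₁‖ ≤ 1/2` — and is
provable now; they are registered so that the closed pieces land as
`Theorems/ContractivityPricePriceOfContractivity<Stub>.lean --supports stmt-ValiantsHypothesis-10583`.
They are not consumed by `PriceOfContractivity_of` (see `sameSize_implies_both` for the formal
implication into the shape of the two composing stubs). The classes are exactly the classical
"no-gap" situations of the structured singular value (`μ = ρ` or `μ = μ̄`): one repeated scalar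
block, triangular and block-triangular-monochrome supports (the determinant only sees the
diagonal blocks), rank one (linear polynomials: the ℓ¹ condition), and normal `K` (`‖K‖ = ρ(K)`). -/

/-- **Partial case (one colour).** If every row carries the same variable `x`, then
`det(1 + x K₀) = ∏ᵢ (1 + λᵢ x)` over the eigenvalues of `K₀`, zero-freeness on `|x| ≤ 2` forces
`|λᵢ| < 1/2`, and `K₁ = diag(λ)` (same size, same colouring) re-realizes with `‖K₁‖ ≤ 1/2`. -/
theorem stub_sameSize_singleColour :
    ∀ (R : ℕ) {σ : Type} (K₀ : Matrix (Fin R) (Fin R) ℂ) (κ : Fin R → σ),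
      (∀ i j, κ i = κ j) →
      (∀ z : σ → ℂ, (∀ j, ‖z j‖ ≤ 2) → MvPolynomial.eval z (1 + Matrix.diagonal (fun i => MvPolynomial.X (κ i)) * K₀.map (fun a : ℂ => (MvPolynomial.C a : MvPolynomial σ ℂ))).det ≠ 0) →
      ∃ (K₁ : Matrix (Fin R) (Fin R) ℂ) (κ₁ : Fin R → σ),
        ‖Matrix.toEuclideanCLM (𝕜 := ℂ) K₁‖ ≤ 1 / 2 ∧
        (1 + Matrix.diagonal (fun i => MvPolynomial.X (κ i)) * K₀.map (fun a : ℂ => (MvPolynomial.C a : MvPolynomial σ ℂ))).det =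
          (1 + Matrix.diagonal (fun i => MvPolynomial.X (κ₁ i)) * K₁.map (fun a : ℂ => (MvPolynomial.C a : MvPolynomial σ ℂ))).det :=
  Summit.ValiantsHypothesis.ValiantsHypothesis.Theorems.PriceOfContractivity.SingleColour.stub_sameSize_singleColour

/-- **Partial case (upper-triangular `K₀`).** If `K₀ i j = 0` for `j < i` then `1 + D_κ K₀` is
upper triangular, `det = ∏ᵢ (1 + K₀ᵢᵢ x_{κ i})`, zero-freeness at the constant points `z ≡ t`,
`|t| ≤ 2`, gives `|K₀ᵢᵢ| < 1/2`, and `K₁ = diag(K₀ᵢᵢ)` (same size and colouring) re-realizes with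
`‖K₁‖ = maxᵢ |K₀ᵢᵢ| ≤ 1/2`. -/
theorem stub_sameSize_upperTriangular :
    ∀ (R : ℕ) {σ : Type} (K₀ : Matrix (Fin R) (Fin R) ℂ) (κ : Fin R → σ),
      (∀ i j : Fin R, j < i → K₀ i j = 0) →
      (∀ z : σ → ℂ, (∀ j, ‖z j‖ ≤ 2) → MvPolynomial.eval z (1 + Matrix.diagonal (fun i => MvPolynomial.X (κ i)) * K₀.map (fun a : ℂ => (MvPolynomial.C a : MvPolynomial σ ℂ))).det ≠ 0) →
      ∃ (K₁ : Matrix (Fin R) (Fin R) ℂ) (κ₁ : Fin R → σ),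
        ‖Matrix.toEuclideanCLM (𝕜 := ℂ) K₁‖ ≤ 1 / 2 ∧
        (1 + Matrix.diagonal (fun i => MvPolynomial.X (κ i)) * K₀.map (fun a : ℂ => (MvPolynomial.C a : MvPolynomial σ ℂ))).det =
          (1 + Matrix.diagonal (fun i => MvPolynomial.X (κ₁ i)) * K₁.map (fun a : ℂ => (MvPolynomial.C a : MvPolynomial σ ℂ))).det :=
  Summit.ValiantsHypothesis.ValiantsHypothesis.Theorems.PriceOfContractivity.UpperTriangular.stub_sameSize_upperTriangular

/-- **Partial case (rank one = linear polynomials).** If `K₀ = u vᵀ` then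
`det(1 + D_κ u vᵀ) = 1 + Σ_e a_e x_e` with `a_e = Σ_{κ i = e} uᵢ vᵢ` (matrix determinant lemma);
zero-freeness on the closed radius-2 polydisc is exactly `Σ_e |a_e| < 1/2` (test the points
`z_e = -2t · ā_e/|a_e|`, `t ∈ [0,1]`), and the rank-one `K₁ = w w'ᵀ` supported on one representative
row per colour with `wᵢ w'ᵢ = a_{κ i}`, `|wᵢ| = |w'ᵢ| = √|a_{κ i}|` re-realizes at the same size
with `‖K₁‖ ≤ ‖w‖ ‖w'‖ = Σ_e |a_e| ≤ 1/2` (the rank-one instance of `μ = μ̄`). -/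
theorem stub_sameSize_rankOne :
    ∀ (R : ℕ) {σ : Type} (K₀ : Matrix (Fin R) (Fin R) ℂ) (κ : Fin R → σ),
      (∃ u v : Fin R → ℂ, K₀ = Matrix.vecMulVec u v) →
      (∀ z : σ → ℂ, (∀ j, ‖z j‖ ≤ 2) → MvPolynomial.eval z (1 + Matrix.diagonal (fun i => MvPolynomial.X (κ i)) * K₀.map (fun a : ℂ => (MvPolynomial.C a : MvPolynomial σ ℂ))).det ≠ 0) →
      ∃ (K₁ : Matrix (Fin R) (Fin R) ℂ) (κ₁ : Fin R → σ),
        ‖Matrix.toEuclideanCLM (𝕜 := ℂ) K₁‖ ≤ 1 / 2 ∧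
        (1 + Matrix.diagonal (fun i => MvPolynomial.X (κ i)) * K₀.map (fun a : ℂ => (MvPolynomial.C a : MvPolynomial σ ℂ))).det =
          (1 + Matrix.diagonal (fun i => MvPolynomial.X (κ₁ i)) * K₁.map (fun a : ℂ => (MvPolynomial.C a : MvPolynomial σ ℂ))).det :=
  Summit.ValiantsHypothesis.ValiantsHypothesis.Theorems.PriceOfContractivity.RankOne.stub_sameSize_rankOne

/-- **Partial case (normal `K₀`).** If `K₀ᴴ K₀ = K₀ K₀ᴴ` then `‖K₀‖_op = ρ(K₀)` (spectral radius,
C⋆-identity for normal elements), every eigenvalue `λ` of `K₀` has `|λ| < 1/2` (zero-freeness at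
the constant point `z ≡ -1/λ` when `|λ| ≥ 1/2`), so `K₁ = K₀` itself already has `‖K₁‖ ≤ 1/2`
(the normal instance of "no scaling gap": `ρ ≤ μ ≤ ‖·‖`). -/
theorem stub_sameSize_normal :
    ∀ (R : ℕ) {σ : Type} (K₀ : Matrix (Fin R) (Fin R) ℂ) (κ : Fin R → σ),
      K₀.conjTranspose * K₀ = K₀ * K₀.conjTranspose →
      (∀ z : σ → ℂ, (∀ j, ‖z j‖ ≤ 2) → MvPolynomial.eval z (1 + Matrix.diagonal (fun i => MvPolynomial.X (κ i)) * K₀.map (fun a : ℂ => (MvPolynomial.C a : MvPolynomial σ ℂ))).det ≠ 0) →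
      ∃ (K₁ : Matrix (Fin R) (Fin R) ℂ) (κ₁ : Fin R → σ),
        ‖Matrix.toEuclideanCLM (𝕜 := ℂ) K₁‖ ≤ 1 / 2 ∧
        (1 + Matrix.diagonal (fun i => MvPolynomial.X (κ i)) * K₀.map (fun a : ℂ => (MvPolynomial.C a : MvPolynomial σ ℂ))).det =
          (1 + Matrix.diagonal (fun i => MvPolynomial.X (κ₁ i)) * K₁.map (fun a : ℂ => (MvPolynomial.C a : MvPolynomial σ ℂ))).det :=
  Summit.ValiantsHypothesis.ValiantsHypothesis.Theorems.PriceOfContractivity.Normal.stub_sameSize_normal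

/-- **Partial case (block-triangular support with monochrome diagonal blocks).** If there is a rank
function `r : Fin R → ℕ` with `K₀ i j = 0` whenever `r j < r i` (block upper-triangular along `r`)
and `κ` constant on the level sets of `r` (each diagonal block carries one variable), then
`det(1 + D_κ K₀) = ∏_a det(1 + x_{e_a} K₀[r = a]) = ∏ᵢ (1 + λᵢ x_{κ i})` (the determinant only
sees the diagonal blocks; eigenvalues blockwise), `|λᵢ| < 1/2`, and `K₁ = diag(λ)` with `κ₁ = κ`
re-realizes at the same size with `‖K₁‖ ≤ 1/2`. Subsumes the one-colour (`r ≡ 0`) and the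
upper-triangular (`r = id`) cases and the commutant case (`K₀` block-diagonal by colour). -/
theorem stub_sameSize_monochromeBlocks :
    ∀ (R : ℕ) {σ : Type} (K₀ : Matrix (Fin R) (Fin R) ℂ) (κ : Fin R → σ),
      (∃ r : Fin R → ℕ, (∀ i j : Fin R, r j < r i → K₀ i j = 0) ∧ (∀ i j : Fin R, r i = r j → κ i = κ j)) →
      (∀ z : σ → ℂ, (∀ j, ‖z j‖ ≤ 2) → MvPolynomial.eval z (1 + Matrix.diagonal (fun i => MvPolynomial.X (κ i)) * K₀.map (fun a : ℂ => (MvPolynomial.C a : MvPolynomial σ ℂ))).det ≠ 0) →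
      ∃ (K₁ : Matrix (Fin R) (Fin R) ℂ) (κ₁ : Fin R → σ),
        ‖Matrix.toEuclideanCLM (𝕜 := ℂ) K₁‖ ≤ 1 / 2 ∧
        (1 + Matrix.diagonal (fun i => MvPolynomial.X (κ i)) * K₀.map (fun a : ℂ => (MvPolynomial.C a : MvPolynomial σ ℂ))).det =
          (1 + Matrix.diagonal (fun i => MvPolynomial.X (κ₁ i)) * K₁.map (fun a : ℂ => (MvPolynomial.C a : MvPolynomial σ ℂ))).det :=
  Summit.ValiantsHypothesis.ValiantsHypothesis.Theorems.PriceOfContractivity.MonochromeBlocks.stub_sameSize_monochromeBlocks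

/-- **Why the partial cases are partial cases of BOTH composing stubs** (formal shape check): a
same-size re-realization with `‖K₁‖ ≤ 1/2` yields the conclusion of `stub_balancedBudget`
(any `d ≥ 1`: `R ≤ 2 ^ L ≤ 2 ^ ((L+d)^d)`, `1/2 ≤ 2 ^ ((L+d)^d)`) and of `stub_normHalving`
(any `c`: `R ≤ 2 ^ ((log₂ n + c)^c) · R`, `1/2 ≤ 1 ≤ M`). -/
theorem sameSize_implies_both {R : ℕ} {σ : Type} (K₀ : Matrix (Fin R) (Fin R) ℂ) (κ : Fin R → σ)
    (h : ∃ (K₁ : Matrix (Fin R) (Fin R) ℂ) (κ₁ : Fin R → σ),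
        ‖Matrix.toEuclideanCLM (𝕜 := ℂ) K₁‖ ≤ 1 / 2 ∧
        (1 + Matrix.diagonal (fun i => MvPolynomial.X (κ i)) * K₀.map (fun a : ℂ => (MvPolynomial.C a : MvPolynomial σ ℂ))).det =
          (1 + Matrix.diagonal (fun i => MvPolynomial.X (κ₁ i)) * K₁.map (fun a : ℂ => (MvPolynomial.C a : MvPolynomial σ ℂ))).det) :
    (∀ (L d : ℕ), 1 ≤ d → R ≤ 2 ^ L →
      ∃ R₁ ≤ 2 ^ ((L + d) ^ d), ∃ (K₁ : Matrix (Fin R₁) (Fin R₁) ℂ) (κ₁ : Fin R₁ → σ),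
        ‖Matrix.toEuclideanCLM (𝕜 := ℂ) K₁‖ ≤ (2 : ℝ) ^ ((L + d) ^ d) ∧
        (1 + Matrix.diagonal (fun i => MvPolynomial.X (κ i)) * K₀.map (fun a : ℂ => (MvPolynomial.C a : MvPolynomial σ ℂ))).det =
          (1 + Matrix.diagonal (fun i => MvPolynomial.X (κ₁ i)) * K₁.map (fun a : ℂ => (MvPolynomial.C a : MvPolynomial σ ℂ))).det) ∧
    (∀ (n c : ℕ) (M : ℝ), 1 ≤ M →
      ∃ R' ≤ 2 ^ ((Nat.log 2 n + c) ^ c) * R, ∃ (K' : Matrix (Fin R') (Fin R') ℂ) (κ' : Fin R' → σ),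
        ‖Matrix.toEuclideanCLM (𝕜 := ℂ) K'‖ ≤ M ∧
        (1 + Matrix.diagonal (fun i => MvPolynomial.X (κ i)) * K₀.map (fun a : ℂ => (MvPolynomial.C a : MvPolynomial σ ℂ))).det =
          (1 + Matrix.diagonal (fun i => MvPolynomial.X (κ' i)) * K'.map (fun a : ℂ => (MvPolynomial.C a : MvPolynomial σ ℂ))).det) := by
  obtain ⟨K₁, κ₁, hK₁, hdet⟩ := h
  refine ⟨fun L d hd hR => ⟨R, ?_, K₁, κ₁, hK₁.trans ?_, hdet⟩, fun n c M hM => ⟨R, ?_, K₁, κ₁, ?_, hdet⟩⟩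
  · -- `R ≤ 2 ^ L ≤ 2 ^ ((L + d) ^ d)` since `L ≤ (L + d) ^ d` for `d ≥ 1`
    refine hR.trans (Nat.pow_le_pow_right two_pos ?_)
    calc L ≤ L + d := Nat.le_add_right L d
      _ = (L + d) ^ 1 := (pow_one _).symm
      _ ≤ (L + d) ^ d := Nat.pow_le_pow_right (by omega) hd
  · have h1 : (1 : ℝ) ≤ (2 : ℝ) ^ ((L + d) ^ d) := one_le_pow₀ (by norm_num)
    linarith
  · exact Nat.le_mul_of_pos_left R (Nat.pow_pos two_pos)
  · linarith

/-! ## §2d Registered partial cases (rev 5): multiaffine budget, two colours, two variables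

Three further landing-grade statements (not consumed by the composition): the MULTIAFFINE
balanced budget (injective colouring: same size, polynomial norm — Theorem 5 of the wave-1
analysis, now provable from the landed cycle-mean bound); the TWO-COLOUR case of ♦ and the
TWO-VARIABLE case of the crux itself, both conditional on the published bivariate realization
theorem [GrinshpanEtAl2014, Thm. 2.1] (Grinshpan–Kaliuzhnyi-Verbovetskyi–Vinnikov–Woerdeman,
*Stable and real-zero polynomials in two variables*, MSSP 27 (2016) = arXiv:1306.6655), whose
statement — in the route's inline Sylvester vocabulary — is taken as an explicit HYPOTHESIS
(spelled out verbatim; the named-fact `def` travels with the landing file and is relocated to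
`Literature/Analysis/OperatorTheory/` by the gate). -/

/-- **Partial case (multiaffine balanced budget, same size, polynomial norm).** For an injective
colouring every principal minor of `K₀` has modulus `< 2^{-|S|}` (restrict the pencil to the
variables of `S`), so the cycle-mean bound (`cycleBound_holds`, `ν = 1/2`) and max-plus balancing
give a positive diagonal similarity `K₁ = D K₀ D⁻¹` with all entries `≤ 120 R³`, the SAME pencil
determinant (same `κ`) and `‖K₁‖_op ≤ R² · 120 R³`. -/
theorem stub_balancedBudget_injective :
    ∀ (R : ℕ) {σ : Type} (K₀ : Matrix (Fin R) (Fin R) ℂ) (κ : Fin R → σ),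
      Function.Injective κ →
      (∀ z : σ → ℂ, (∀ j, ‖z j‖ ≤ 2) → MvPolynomial.eval z (1 + Matrix.diagonal (fun i => MvPolynomial.X (κ i)) * K₀.map (fun a : ℂ => (MvPolynomial.C a : MvPolynomial σ ℂ))).det ≠ 0) →
      ∃ (K₁ : Matrix (Fin R) (Fin R) ℂ),
        ‖Matrix.toEuclideanCLM (𝕜 := ℂ) K₁‖ ≤ 120 * (R : ℝ) ^ 5 ∧
        (1 + Matrix.diagonal (fun i => MvPolynomial.X (κ i)) * K₀.map (fun a : ℂ => (MvPolynomial.C a : MvPolynomial σ ℂ))).det =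
          (1 + Matrix.diagonal (fun i => MvPolynomial.X (κ i)) * K₁.map (fun a : ℂ => (MvPolynomial.C a : MvPolynomial σ ℂ))).det :=
  Summit.ValiantsHypothesis.ValiantsHypothesis.Theorems.PriceOfContractivity.BalancedBudgetInjective.stub_balancedBudget_injective

/-- **Partial case (two colours) of ♦, conditional on [GrinshpanEtAl2014, Thm. 2.1]** (the
hypothesis, verbatim: every non-constant bivariate `p` with `p(0) = 1` and no zero in the open
polydisc `r𝔻²` is `det (1 + diag (X ∘ κ) K)` with `#κ⁻¹(j) = deg_j p` and `‖K‖_op ≤ r⁻¹`).  With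
at most two colours the pencil determinant is a renamed bivariate polynomial of stability radius
`≥ 2`, so the theorem re-realizes it with `‖K₁‖ ≤ 1/2` at size `≤ 2R`, and entries `≤ 1` bound
every `(k+1)`-minor by `(k+1)! ≤ (2^(L+1))^(k+1)`: `d = 1`. -/
theorem stub_stableLifting_twoColour :
    (∀ (p : MvPolynomial (Fin 2) ℂ) (r : ℝ), 0 < r →
      MvPolynomial.eval (0 : Fin 2 → ℂ) p = 1 → 0 < p.totalDegree →
      (∀ z : Fin 2 → ℂ, (∀ j, ‖z j‖ < r) → MvPolynomial.eval z p ≠ 0) →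
      ∃ (K : Matrix (Fin (p.degreeOf 0 + p.degreeOf 1)) (Fin (p.degreeOf 0 + p.degreeOf 1)) ℂ)
        (κ : Fin (p.degreeOf 0 + p.degreeOf 1) → Fin 2),
        (∀ j : Fin 2, (Finset.univ.filter fun i => κ i = j).card = p.degreeOf j) ∧
        ‖Matrix.toEuclideanCLM (𝕜 := ℂ) K‖ ≤ r⁻¹ ∧
        p = (1 + Matrix.diagonal (fun i => MvPolynomial.X (κ i)) *
              K.map (fun a : ℂ => (MvPolynomial.C a : MvPolynomial (Fin 2) ℂ))).det) →
    ∃ d : ℕ, ∀ (L R : ℕ) {σ : Type} (K₀ : Matrix (Fin R) (Fin R) ℂ) (κ : Fin R → σ),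
      (∃ a b : σ, ∀ i, κ i = a ∨ κ i = b) →
      R ≤ 2 ^ L →
      (∀ z : σ → ℂ, (∀ j, ‖z j‖ ≤ 2) → MvPolynomial.eval z (1 + Matrix.diagonal (fun i => MvPolynomial.X (κ i)) * K₀.map (fun a : ℂ => (MvPolynomial.C a : MvPolynomial σ ℂ))).det ≠ 0) →
      ∃ R₁ ≤ 2 ^ ((L + d) ^ d), ∃ (K₁ : Matrix (Fin R₁) (Fin R₁) ℂ) (κ₁ : Fin R₁ → σ),
        (∀ (k : ℕ) (w : Fin (k + 1) → Fin R₁), Function.Injective w →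
          ‖(K₁.submatrix w w).det‖ ≤ ((2 : ℝ) ^ ((L + d) ^ d)) ^ (k + 1)) ∧
        (1 + Matrix.diagonal (fun i => MvPolynomial.X (κ i)) * K₀.map (fun a : ℂ => (MvPolynomial.C a : MvPolynomial σ ℂ))).det =
          (1 + Matrix.diagonal (fun i => MvPolynomial.X (κ₁ i)) * K₁.map (fun a : ℂ => (MvPolynomial.C a : MvPolynomial σ ℂ))).det :=
  Summit.ValiantsHypothesis.ValiantsHypothesis.Theorems.PriceOfContractivity.StableLifting.stub_stableLifting_twoColour

/-- **Partial case (two variables) of the CRUX, conditional on [GrinshpanEtAl2014, Thm. 2.1]**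
(same verbatim hypothesis).  For `#σ ≤ 2` the normalised polynomial `p/p(0)` is a renamed
bivariate polynomial with no zero on the closed radius-2 bidisc, of total degree `≤ m` (it is an
`m × m` affine determinant), so the theorem gives a realization with `‖K‖ ≤ 1/2 ≤ 1` of size
`deg₀ + deg₁ ≤ 2m ≤ 2 ^ ((log₂ (m+N) + 2)^2)` (and size `0` when `p` is constant): the conclusion
of `PriceOfContractivity` with `d = 2`, restricted to `N ≤ 2`. -/
theorem stub_priceOfContractivity_twoVar :
    (∀ (p : MvPolynomial (Fin 2) ℂ) (r : ℝ), 0 < r →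
      MvPolynomial.eval (0 : Fin 2 → ℂ) p = 1 → 0 < p.totalDegree →
      (∀ z : Fin 2 → ℂ, (∀ j, ‖z j‖ < r) → MvPolynomial.eval z p ≠ 0) →
      ∃ (K : Matrix (Fin (p.degreeOf 0 + p.degreeOf 1)) (Fin (p.degreeOf 0 + p.degreeOf 1)) ℂ)
        (κ : Fin (p.degreeOf 0 + p.degreeOf 1) → Fin 2),
        (∀ j : Fin 2, (Finset.univ.filter fun i => κ i = j).card = p.degreeOf j) ∧
        ‖Matrix.toEuclideanCLM (𝕜 := ℂ) K‖ ≤ r⁻¹ ∧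
        p = (1 + Matrix.diagonal (fun i => MvPolynomial.X (κ i)) *
              K.map (fun a : ℂ => (MvPolynomial.C a : MvPolynomial (Fin 2) ℂ))).det) →
    ∀ (N m : ℕ) {σ : Type} [Fintype σ] (p : MvPolynomial σ ℂ), N ≤ 2 → Fintype.card σ ≤ N →
      Literature.Computability.AlgebraicComplexity.HasDetRepr p m →
      (∀ z : σ → ℂ, (∀ j, ‖z j‖ ≤ 2) → MvPolynomial.eval z p ≠ 0) →
      ∃ R ≤ 2 ^ ((Nat.log 2 (m + N) + 2) ^ 2), ∃ (K : Matrix (Fin R) (Fin R) ℂ) (κ : Fin R → σ),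
        ‖Matrix.toEuclideanCLM (𝕜 := ℂ) K‖ ≤ 1 ∧
        p = MvPolynomial.C (MvPolynomial.eval 0 p) *
          (1 + Matrix.diagonal (fun i => MvPolynomial.X (κ i)) * K.map (fun a : ℂ => (MvPolynomial.C a : MvPolynomial σ ℂ))).det :=
  Summit.ValiantsHypothesis.ValiantsHypothesis.Theorems.PriceOfContractivity.TwoVar.stub_priceOfContractivity_twoVar

/-! ## §2e Registered partial cases (rev 6): one large colour class; the multiaffine halving regime

`stub_stableLifting_oneLargeClass`: ♦ when all rows but at most two carry one colour (colourings
`(n)`, `(n,1)`, `(n,2)`, `(n,1,1)`), UNCONDITIONAL — paper proof `Lines/birth-lifting2.md` Theorem A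
(Schur-complement peeling of the big class, a "trie" determinantal identity putting the bounded
coefficients into the matrix with RANK-ONE dependence on the peeled variable, and a backward-shift
model-space realization with prescribed `det(I + xA') = p(x,0)` and `‖A'‖ ≤ 1/2`; size `R + 1`,
entries `≤ 1`, `d = 1`).  `stub_normHalving_injectiveBudget`: the halving stub in the multiaffine
budget regime `120 R⁵ ≤ M` (free at the same size by the landed multiaffine balanced budget). -/

/-- **Partial case (♦ with one large colour class + ≤ 2 further rows)**, unconditional: size
`R₁ ≤ R + 1`, all entries of `K₁` of modulus `≤ 1`, hence `(k+1)`-minors `≤ (k+1)! ≤ (2^(L+1))^(k+1)`,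
`d = 1`.  Paper proof: Lines/birth-lifting2.md §2. -/
theorem stub_stableLifting_oneLargeClass :
    ∃ d : ℕ, ∀ (L R : ℕ) {σ : Type} (K₀ : Matrix (Fin R) (Fin R) ℂ) (κ : Fin R → σ),
      (∃ a : σ, Nat.card {i : Fin R // κ i ≠ a} ≤ 2) →
      R ≤ 2 ^ L →
      (∀ z : σ → ℂ, (∀ j, ‖z j‖ ≤ 2) → MvPolynomial.eval z (1 + Matrix.diagonal (fun i => MvPolynomial.X (κ i)) * K₀.map (fun a : ℂ => (MvPolynomial.C a : MvPolynomial σ ℂ))).det ≠ 0) →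
      ∃ R₁ ≤ 2 ^ ((L + d) ^ d), ∃ (K₁ : Matrix (Fin R₁) (Fin R₁) ℂ) (κ₁ : Fin R₁ → σ),
        (∀ (k : ℕ) (w : Fin (k + 1) → Fin R₁), Function.Injective w →
          ‖(K₁.submatrix w w).det‖ ≤ ((2 : ℝ) ^ ((L + d) ^ d)) ^ (k + 1)) ∧
        (1 + Matrix.diagonal (fun i => MvPolynomial.X (κ i)) * K₀.map (fun a : ℂ => (MvPolynomial.C a : MvPolynomial σ ℂ))).det =
          (1 + Matrix.diagonal (fun i => MvPolynomial.X (κ₁ i)) * K₁.map (fun a : ℂ => (MvPolynomial.C a : MvPolynomial σ ℂ))).det :=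
  Summit.ValiantsHypothesis.ValiantsHypothesis.Theorems.PriceOfContractivity.OneLargeClass.stub_stableLifting_oneLargeClass

/-- **Partial case (norm halving, multiaffine budget regime).** For injective `κ` and
`120 R⁵ ≤ M` one halving is free at the same size (`c = 0`): the landed multiaffine balanced budget
gives `K₁ = D K D⁻¹` with `‖K₁‖ ≤ 120 R⁵ ≤ M` and the same pencil determinant. -/
theorem stub_normHalving_injectiveBudget :
    ∃ c : ℕ, ∀ (n R : ℕ) (M : ℝ) {σ : Type} [Fintype σ] (K : Matrix (Fin R) (Fin R) ℂ) (κ : Fin R → σ),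
      Function.Injective κ →
      120 * (R : ℝ) ^ 5 ≤ M →
      Fintype.card σ ≤ n →
      (1 + Matrix.diagonal (fun i => MvPolynomial.X (κ i)) * K.map (fun a : ℂ => (MvPolynomial.C a : MvPolynomial σ ℂ))).det.totalDegree ≤ n →
      1 ≤ M →
      ‖Matrix.toEuclideanCLM (𝕜 := ℂ) K‖ ≤ 2 * M →
      (∀ z : σ → ℂ, (∀ j, ‖z j‖ ≤ 2) → MvPolynomial.eval z (1 + Matrix.diagonal (fun i => MvPolynomial.X (κ i)) * K.map (fun a : ℂ => (MvPolynomial.C a : MvPolynomial σ ℂ))).det ≠ 0) →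
      ∃ R' ≤ 2 ^ ((Nat.log 2 n + c) ^ c) * R, ∃ (K' : Matrix (Fin R') (Fin R') ℂ) (κ' : Fin R' → σ),
        ‖Matrix.toEuclideanCLM (𝕜 := ℂ) K'‖ ≤ M ∧
        (1 + Matrix.diagonal (fun i => MvPolynomial.X (κ i)) * K.map (fun a : ℂ => (MvPolynomial.C a : MvPolynomial σ ℂ))).det =
          (1 + Matrix.diagonal (fun i => MvPolynomial.X (κ' i)) * K'.map (fun a : ℂ => (MvPolynomial.C a : MvPolynomial σ ℂ))).det :=
  Summit.ValiantsHypothesis.ValiantsHypothesis.Theorems.PriceOfContractivity.NormHalving.stub_normHalving_injectiveBudget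

/-! ## §2c Proved glue (rev 4): the balanced budget from lifting + cycle bound + balancing -/

section BudgetGlue

/-- Theorem 4 assembled from its registered pieces (modus ponens). -/
theorem cycleBound_holds : Sig.cycleBound :=
  stub_cycleBound stub_cycleBalancing (stub_arcInduction stub_arcStep stub_permCounts)

/-- Entrywise bound ⟹ operator-norm bound: if every entry of `K ∈ ℂ^{R×R}` has modulus `≤ M`
(`M ≥ 0`) then `‖K‖_op ≤ R² · M` (crude: `|(Kx)_i| ≤ M · R · ‖x‖` and `‖y‖₂ ≤ Σ |y_i|`).
[folklore] -/
theorem norm_toEuclideanCLM_le_of_entry_le {R : ℕ} (K : Matrix (Fin R) (Fin R) ℂ) {M : ℝ}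
    (hM : 0 ≤ M) (h : ∀ i j, ‖K i j‖ ≤ M) :
    ‖Matrix.toEuclideanCLM (𝕜 := ℂ) K‖ ≤ (R : ℝ) ^ 2 * M := by
  refine ContinuousLinearMap.opNorm_le_bound _ (by positivity) fun x => ?_
  have hx : ∀ j, ‖x j‖ ≤ ‖x‖ := fun j => PiLp.norm_apply_le x j
  -- each coordinate of `K x`
  have hcoord : ∀ i, ‖(Matrix.toEuclideanCLM (𝕜 := ℂ) K x) i‖ ≤ M * ((R : ℝ) * ‖x‖) := by
    intro i
    have hKi : (Matrix.toEuclideanCLM (𝕜 := ℂ) K x) i = ∑ j, K i j * x j := by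
      rw [Matrix.ofLp_toEuclideanCLM]
      rfl
    rw [hKi]
    calc ‖∑ j, K i j * x j‖ ≤ ∑ j, ‖K i j * x j‖ := norm_sum_le _ _
      _ ≤ ∑ _j : Fin R, M * ‖x‖ := Finset.sum_le_sum fun j _ => by
          rw [norm_mul]
          exact mul_le_mul (h i j) (hx j) (norm_nonneg _) hM
      _ = M * ((R : ℝ) * ‖x‖) := by
          rw [Finset.sum_const, Finset.card_univ, Fintype.card_fin, nsmul_eq_mul]; ring
  -- `‖K x‖ ≤ Σ_i ‖(K x)_i‖ ≤ R · (M R ‖x‖)`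
  have hsum : ‖Matrix.toEuclideanCLM (𝕜 := ℂ) K x‖ ≤
      ∑ i, ‖(Matrix.toEuclideanCLM (𝕜 := ℂ) K x) i‖ := by
    rw [EuclideanSpace.norm_eq]
    refine Real.sqrt_le_iff.mpr ⟨Finset.sum_nonneg fun i _ => norm_nonneg _, ?_⟩
    exact Finset.sum_sq_le_sq_sum_of_nonneg fun i _ => norm_nonneg _
  calc ‖Matrix.toEuclideanCLM (𝕜 := ℂ) K x‖
      ≤ ∑ i, ‖(Matrix.toEuclideanCLM (𝕜 := ℂ) K x) i‖ := hsum
    _ ≤ ∑ _i : Fin R, M * ((R : ℝ) * ‖x‖) := Finset.sum_le_sum fun i _ => hcoord i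
    _ = (R : ℝ) ^ 2 * M * ‖x‖ := by
        rw [Finset.sum_const, Finset.card_univ, Fintype.card_fin, nsmul_eq_mul]; ring

/-- **Pencil invariance under diagonal similarity.** For `d i ≠ 0`,
`det(1 + D_κ · (D K D⁻¹)) = det(1 + D_κ · K)` with `D = diag(d)`: `D` commutes with `D_κ`, so the
two pencils are intertwined by `D.map C` (proved without inverses: `P₂ · D = D · P₁`). [folklore] -/
theorem det_pencil_diagConj {R : ℕ} {σ : Type} (K : Matrix (Fin R) (Fin R) ℂ) (κ : Fin R → σ)
    (d : Fin R → ℂ) (hd : ∀ i, d i ≠ 0) :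
    (1 + Matrix.diagonal (fun i => MvPolynomial.X (κ i)) *
        (Matrix.of fun i j => d i * K i j * (d j)⁻¹).map
          (fun a : ℂ => (MvPolynomial.C a : MvPolynomial σ ℂ))).det =
      (1 + Matrix.diagonal (fun i => MvPolynomial.X (κ i)) *
        K.map (fun a : ℂ => (MvPolynomial.C a : MvPolynomial σ ℂ))).det := by
  set D : Matrix (Fin R) (Fin R) (MvPolynomial σ ℂ) := Matrix.diagonal fun i => MvPolynomial.C (d i)
    with hD
  set P₁ : Matrix (Fin R) (Fin R) (MvPolynomial σ ℂ) :=
    1 + Matrix.diagonal (fun i => MvPolynomial.X (κ i)) *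
      K.map (fun a : ℂ => (MvPolynomial.C a : MvPolynomial σ ℂ)) with hP₁
  set P₂ : Matrix (Fin R) (Fin R) (MvPolynomial σ ℂ) :=
    1 + Matrix.diagonal (fun i => MvPolynomial.X (κ i)) *
      (Matrix.of fun i j => d i * K i j * (d j)⁻¹).map
        (fun a : ℂ => (MvPolynomial.C a : MvPolynomial σ ℂ)) with hP₂
  -- the intertwining identity
  have hint : P₂ * D = D * P₁ := by
    refine Matrix.ext fun i j => ?_
    have hj' : (MvPolynomial.C (d j)⁻¹ : MvPolynomial σ ℂ) * MvPolynomial.C (d j) = 1 := by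
      rw [← map_mul, inv_mul_cancel₀ (hd j), map_one]
    simp only [hP₁, hP₂, hD, Matrix.mul_diagonal, Matrix.diagonal_mul, Matrix.add_apply,
      Matrix.one_apply, Matrix.map_apply, Matrix.of_apply, map_mul]
    by_cases hij : i = j
    · subst hij
      simp only [if_true]
      linear_combination (MvPolynomial.X (κ i) * MvPolynomial.C (d i) * MvPolynomial.C (K i i)) * hj'
    · simp only [if_neg hij]
      linear_combination (MvPolynomial.X (κ i) * MvPolynomial.C (d i) * MvPolynomial.C (K i j)) * hj'
  have hdetD : D.det ≠ 0 := by
    rw [hD, Matrix.det_diagonal]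
    exact Finset.prod_ne_zero_iff.mpr fun i _ => by
      rw [Ne, MvPolynomial.C_eq_zero]; exact hd i
  have := congrArg Matrix.det hint
  rw [Matrix.det_mul, Matrix.det_mul, mul_comm D.det] at this
  exact mul_right_cancel₀ hdetD this

/-- The exponent arithmetic of the rev-4 budget glue: with `B = (L+d)^d`, `R₁ ≤ 2^B`, the final
norm bound `R₁² · (240 R₁³ 2^B + 1)` is at most `2 ^ ((L + (d+6))^(d+6))`. -/
theorem exponent_bound₃ (d L R₁ : ℕ) (hR : R₁ ≤ 2 ^ ((L + d) ^ d)) :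
    R₁ ^ 2 * (240 * R₁ ^ 3 * 2 ^ ((L + d) ^ d) + 1) ≤ 2 ^ ((L + (d + 6)) ^ (d + 6)) := by
  generalize hB : (L + d) ^ d = B at *
  have h1 : R₁ ^ 2 * (240 * R₁ ^ 3 * 2 ^ B + 1) ≤ 2 ^ (6 * B + 8) := by
    have hR2 : R₁ ^ 2 ≤ 2 ^ (2 * B) := by rw [pow_mul']; exact Nat.pow_le_pow_left hR 2
    have hR3 : R₁ ^ 3 ≤ 2 ^ (3 * B) := by rw [pow_mul']; exact Nat.pow_le_pow_left hR 3
    have h240 : 240 * R₁ ^ 3 * 2 ^ B + 1 ≤ 2 ^ (4 * B + 8) := by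
      have hone : 1 ≤ 2 ^ (4 * B) := Nat.one_le_two_pow
      calc 240 * R₁ ^ 3 * 2 ^ B + 1 ≤ 240 * 2 ^ (3 * B) * 2 ^ B + 2 ^ (4 * B) := by
            have := Nat.mul_le_mul_right (2 ^ B) (Nat.mul_le_mul_left 240 hR3); omega
        _ = 241 * 2 ^ (4 * B) := by ring
        _ ≤ 2 ^ 8 * 2 ^ (4 * B) := Nat.mul_le_mul_right _ (by norm_num)
        _ = 2 ^ (4 * B + 8) := by rw [← pow_add]; ring_nf
    calc R₁ ^ 2 * (240 * R₁ ^ 3 * 2 ^ B + 1) ≤ 2 ^ (2 * B) * 2 ^ (4 * B + 8) :=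
          Nat.mul_le_mul hR2 h240
      _ = 2 ^ (6 * B + 8) := by rw [← pow_add]; ring_nf
  refine h1.trans (Nat.pow_le_pow_right two_pos ?_)
  -- `6 B + 8 ≤ (L + d + 6)^(d + 6)` from `B ≤ (L+d+6)^d` and `6^6 ≥ 14`
  have hB' : B ≤ (L + (d + 6)) ^ d := by
    rw [← hB]; exact Nat.pow_le_pow_left (by omega) d
  have h66 : 46656 ≤ (L + (d + 6)) ^ 6 := by
    calc 46656 = 6 ^ 6 := by norm_num
      _ ≤ (L + (d + 6)) ^ 6 := Nat.pow_le_pow_left (by omega) 6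
  have hX1 : 1 ≤ (L + (d + 6)) ^ d := Nat.one_le_pow d (L + (d + 6)) (by omega)
  calc 6 * B + 8 ≤ 46656 * (L + (d + 6)) ^ d := by omega
    _ ≤ (L + (d + 6)) ^ 6 * (L + (d + 6)) ^ d := Nat.mul_le_mul_right _ h66
    _ = (L + (d + 6)) ^ (d + 6) := by rw [← pow_add, add_comm 6 d]

/-- **The balanced budget (rev-3 `stub_balancedBudget`) from lifting, the cycle-mean bound and
balancing.** Given the lifted `K₁` (all principal minors `≤ B₁^{size}`, `B₁ = 2^((L+d)^d)`),
Theorem 4 bounds every cycle product by `(240 R₁³ B₁)^{length}`, balancing by a positive diagonal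
`D` makes every entry of `D K₁ D⁻¹` at most `240 R₁³ B₁ + 1`, the pencil determinant is unchanged
(`det_pencil_diagConj`) and the operator norm is `≤ R₁² (240 R₁³ B₁ + 1) ≤ 2^((L+d+6)^(d+6))`. -/
theorem balancedBudget_of (hlift : Sig.stub_stableLifting) (hbal : Sig.balancing)
    (hcyc : Sig.cycleBound) : Sig.stub_balancedBudget := by
  obtain ⟨d, hd⟩ := hlift
  refine ⟨d + 6, ?_⟩
  intro L R σ K₀ κ hR hz
  obtain ⟨R₁, hR₁, K₁, κ₁, hmin, hdet⟩ := hd L R K₀ κ hR hz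
  -- Theorem 4: cycle products of `K₁`
  set B₁ : ℝ := (2 : ℝ) ^ ((L + d) ^ d) with hB₁
  have hB₁0 : 0 ≤ B₁ := by positivity
  have hcycK := hcyc R₁ K₁ B₁ hB₁0 hmin
  -- balancing at level `M = 240 R₁³ B₁ + 1 > 0`
  set M : ℝ := 240 * (R₁ : ℝ) ^ 3 * B₁ + 1 with hM
  have hM0 : 0 < M := by positivity
  have hcycM : ∀ (n : ℕ) (v : Fin (n + 1) → Fin R₁), Function.Injective v →
      ‖∏ t : Fin (n + 1), K₁ (v t) (v (t + 1))‖ ≤ M ^ (n + 1) := by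
    intro n v hv
    refine (hcycK n v hv).trans (pow_le_pow_left₀ (by positivity) ?_ _)
    rw [hM]; linarith
  obtain ⟨dd, hdd0, hdd⟩ := hbal R₁ K₁ M hM0 hcycM
  -- the balanced matrix
  set K₂ : Matrix (Fin R₁) (Fin R₁) ℂ :=
    Matrix.of fun i j => ((dd i : ℝ) : ℂ) * K₁ i j * (((dd j : ℝ) : ℂ))⁻¹ with hK₂
  have hentry : ∀ i j, ‖K₂ i j‖ ≤ M := by
    intro i j
    rw [hK₂, Matrix.of_apply, norm_mul, norm_mul, norm_inv, Complex.norm_real, Complex.norm_real,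
      Real.norm_of_nonneg (hdd0 i).le, Real.norm_of_nonneg (hdd0 j).le]
    have := hdd i j
    rwa [div_eq_mul_inv] at this
  have hnorm : ‖Matrix.toEuclideanCLM (𝕜 := ℂ) K₂‖ ≤ (R₁ : ℝ) ^ 2 * M :=
    norm_toEuclideanCLM_le_of_entry_le K₂ hM0.le hentry
  have hdet₂ := det_pencil_diagConj K₁ κ₁ (fun i => ((dd i : ℝ) : ℂ))
    (fun i => Complex.ofReal_ne_zero.mpr (hdd0 i).ne')
  refine ⟨R₁, hR₁.trans (Nat.pow_le_pow_right two_pos ?_), K₂, κ₁, hnorm.trans ?_, ?_⟩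
  · -- `(L+d)^d ≤ (L+d+6)^(d+6)`
    calc (L + d) ^ d ≤ (L + (d + 6)) ^ d := Nat.pow_le_pow_left (by omega) d
      _ ≤ (L + (d + 6)) ^ (d + 6) := Nat.pow_le_pow_right (by omega) (by omega)
  · -- the norm arithmetic, transported from `ℕ`
    have hnat := exponent_bound₃ d L R₁ hR₁
    have hcast : (R₁ : ℝ) ^ 2 * M = ((R₁ ^ 2 * (240 * R₁ ^ 3 * 2 ^ ((L + d) ^ d) + 1) : ℕ) : ℝ) := by
      rw [hM, hB₁]; push_cast; ring
    rw [hcast]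
    exact_mod_cast hnat
  · rw [hdet, ← hdet₂]

/-- **Balanced budget** (the rev-3 stub, now a theorem modulo the rev-4 stubs):
`Sig.stub_balancedBudget` from `stub_stableLifting`, `stub_cycleBalancing` and `cycleBound_holds`. -/
theorem stub_balancedBudget : Sig.stub_balancedBudget :=
  balancedBudget_of stub_stableLifting stub_cycleBalancing cycleBound_holds

end BudgetGlue

/-! ## §3 Proved glue 1: the Sylvester normal form of an affine determinantal representation -/

section NormalForm

variable {σ : Type} [Fintype σ] {m : ℕ}

/-- Constant part `A(0)` of a matrix of affine entries. -/
noncomputable def constPart (A : Matrix (Fin m) (Fin m) (MvPolynomial σ ℂ)) : Matrix (Fin m) (Fin m) ℂ :=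
  Matrix.of fun i j => coeff 0 (A i j)

/-- Coefficient matrix `A_e` of the variable `x_e` in a matrix of affine entries. -/
noncomputable def linPart (A : Matrix (Fin m) (Fin m) (MvPolynomial σ ℂ)) (e : σ) : Matrix (Fin m) (Fin m) ℂ :=
  Matrix.of fun i j => coeff (Finsupp.single e 1) (A i j)

/-- An affine matrix is its constant part plus its linear parts. [folklore] -/
theorem eq_constPart_add_linPart (A : Matrix (Fin m) (Fin m) (MvPolynomial σ ℂ))
    (hA : ∀ i j, (A i j).totalDegree ≤ 1) :
    A = ((constPart A).map C + Matrix.of (fun i j => ∑ e, C (linPart A e i j) * X e) :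
      Matrix (Fin m) (Fin m) (MvPolynomial σ ℂ)) := by
  refine Matrix.ext fun i j => ?_
  simp only [Matrix.add_apply, Matrix.map_apply, Matrix.of_apply, constPart, linPart]
  exact LRPencil.eq_affine_of_totalDegree_le_one (A i j) (hA i j)

omit [Fintype σ] in
/-- `eval 0 = constantCoeff` on `MvPolynomial σ ℂ`. [folklore] -/
theorem eval_zero_eq_constantCoeff :
    (MvPolynomial.eval (0 : σ → ℂ) : MvPolynomial σ ℂ →+* ℂ) = MvPolynomial.constantCoeff :=
  MvPolynomial.ringHom_ext (fun r => by simp) (fun i => by simp)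

/-- **Sylvester normal form.** If `p` has an affine determinantal representation of size `m` and
`p(0) ≠ 0`, then `p = p(0) · det(1 + diag(x ∘ κ) · K)` for some `K ∈ ℂ^{R×R}`, `κ : [R] → σ`, with
`R ≤ #σ · m` (write `A = A(0) + Σ_e x_e A_e`, rank-factor the `A_e`, pull out `A(0)` and commute the
rectangular factors: the tree's `det_add_linearPart_eq`). [folklore] -/
theorem normalForm_of_hasDetRepr {p : MvPolynomial σ ℂ} (h : HasDetRepr p m)
    (hp : MvPolynomial.eval 0 p ≠ 0) :
    ∃ R ≤ Fintype.card σ * m, ∃ (K : Matrix (Fin R) (Fin R) ℂ) (κ : Fin R → σ),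
      p = MvPolynomial.C (MvPolynomial.eval 0 p) *
        (1 + Matrix.diagonal (fun i => MvPolynomial.X (κ i)) * K.map (fun a : ℂ => (MvPolynomial.C a : MvPolynomial σ ℂ))).det := by
  classical
  obtain ⟨A, haff, hdet⟩ := h
  have hA := eq_constPart_add_linPart A haff
  -- `p = det (A(0) + Σ_e x_e A_e)`
  have e1 : p = ((constPart A).map C + Matrix.of (fun i j => ∑ e, C (linPart A e i j) * X e) :
      Matrix (Fin m) (Fin m) (MvPolynomial σ ℂ)).det :=
    hdet.symm.trans (congrArg Matrix.det hA)
  -- `p(0) = det A(0)`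
  have e2 : MvPolynomial.eval 0 p = (constPart A).det := by
    have h1 : MvPolynomial.eval (0 : σ → ℂ) p = MvPolynomial.constantCoeff p := by
      rw [eval_zero_eq_constantCoeff]
    rw [h1, e1, RingHom.map_det, RingHom.mapMatrix_apply]
    exact congrArg Matrix.det (map_constantCoeff_shift (constPart A) (linPart A))
  have hunit : IsUnit (constPart A).det := by
    rw [← e2]
    exact isUnit_iff_ne_zero.mpr hp
  obtain ⟨R, hR, K, κ, hK⟩ := det_add_linearPart_eq (constPart A) hunit (linPart A)
  have hR' : R ≤ Fintype.card σ * m := by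
    refine hR.trans ?_
    calc ∑ e, (linPart A e).rank ≤ ∑ _e : σ, m :=
          Finset.sum_le_sum fun e _ => Matrix.rank_le_width (linPart A e)
      _ = Fintype.card σ * m := by rw [Finset.sum_const, Finset.card_univ, smul_eq_mul]
  refine ⟨R, hR', K, κ, ?_⟩
  rw [e2]
  exact e1.trans hK

end NormalForm

/-! ## §4 Proved glue 2: degree of a pencil determinant; iterating the halving step -/

/-- Every entry of the Sylvester pencil `1 + D_κ · K` is affine (total degree `≤ 1`). [folklore] -/
theorem totalDegree_pencil_entry_le {σ : Type} {R : ℕ} (K : Matrix (Fin R) (Fin R) ℂ) (κ : Fin R → σ)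
    (i j : Fin R) :
    (((1 + Matrix.diagonal (fun i => MvPolynomial.X (κ i)) * K.map (fun a : ℂ => (MvPolynomial.C a : MvPolynomial σ ℂ))) :
      Matrix (Fin R) (Fin R) (MvPolynomial σ ℂ)) i j).totalDegree ≤ 1 := by
  rw [Matrix.add_apply, Matrix.diagonal_mul, Matrix.map_apply]
  refine (MvPolynomial.totalDegree_add _ _).trans (max_le ?_ ?_)
  · rw [Matrix.one_apply]
    split_ifs
    · rw [MvPolynomial.totalDegree_one]; exact Nat.zero_le _
    · rw [MvPolynomial.totalDegree_zero]; exact Nat.zero_le _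
  · refine (MvPolynomial.totalDegree_mul _ _).trans ?_
    rw [MvPolynomial.totalDegree_X, MvPolynomial.totalDegree_C]

/-- The determinant of a Sylvester pencil of size `R` has total degree `≤ R`. [folklore] -/
theorem totalDegree_pencil_det_le {σ : Type} {R : ℕ} (K : Matrix (Fin R) (Fin R) ℂ) (κ : Fin R → σ) :
    (1 + Matrix.diagonal (fun i => MvPolynomial.X (κ i)) * K.map (fun a : ℂ => (MvPolynomial.C a : MvPolynomial σ ℂ))).det.totalDegree ≤ R := by
  have h := Literature.LinearAlgebra.Matrix.totalDegree_det_le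
    (1 + Matrix.diagonal (fun i => MvPolynomial.X (κ i)) * K.map (fun a : ℂ => (MvPolynomial.C a : MvPolynomial σ ℂ))) (fun _ => 1) (fun i j => totalDegree_pencil_entry_le K κ i j)
  simpa using h

/-- **Price within a budget, on a domain (rev 8).** If one halving costs a size factor `q ≥ 1` for
inputs of size `≤ Q` (the halving stub at a fixed bound `n` on #variables and degree), then `b`
halvings bring a realization with `‖K‖ ≤ 2 ^ b` and `q ^ b · R ≤ Q` to a contractive one at size
`≤ q ^ b · R` (induction on `b` with the invariant `q ^ b · R ≤ Q`). -/
theorem priceInBudget_of_normHalvingDom {q Q n : ℕ} (hq : 1 ≤ q)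
    (hc : ∀ (R : ℕ) (M : ℝ) {σ : Type} [Fintype σ] (K : Matrix (Fin R) (Fin R) ℂ) (κ : Fin R → σ),
      R ≤ Q →
      Fintype.card σ ≤ n →
      (1 + Matrix.diagonal (fun i => MvPolynomial.X (κ i)) * K.map (fun a : ℂ => (MvPolynomial.C a : MvPolynomial σ ℂ))).det.totalDegree ≤ n →
      1 ≤ M →
      ‖Matrix.toEuclideanCLM (𝕜 := ℂ) K‖ ≤ 2 * M →
      (∀ z : σ → ℂ, (∀ j, ‖z j‖ ≤ 2) → MvPolynomial.eval z (1 + Matrix.diagonal (fun i => MvPolynomial.X (κ i)) * K.map (fun a : ℂ => (MvPolynomial.C a : MvPolynomial σ ℂ))).det ≠ 0) →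
      ∃ R' ≤ q * R, ∃ (K' : Matrix (Fin R') (Fin R') ℂ) (κ' : Fin R' → σ),
        ‖Matrix.toEuclideanCLM (𝕜 := ℂ) K'‖ ≤ M ∧
        (1 + Matrix.diagonal (fun i => MvPolynomial.X (κ i)) * K.map (fun a : ℂ => (MvPolynomial.C a : MvPolynomial σ ℂ))).det =
          (1 + Matrix.diagonal (fun i => MvPolynomial.X (κ' i)) * K'.map (fun a : ℂ => (MvPolynomial.C a : MvPolynomial σ ℂ))).det)
    (b : ℕ) :
    ∀ (R : ℕ) {σ : Type} [Fintype σ] (K : Matrix (Fin R) (Fin R) ℂ) (κ : Fin R → σ),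
      q ^ b * R ≤ Q →
      Fintype.card σ ≤ n →
      (1 + Matrix.diagonal (fun i => MvPolynomial.X (κ i)) * K.map (fun a : ℂ => (MvPolynomial.C a : MvPolynomial σ ℂ))).det.totalDegree ≤ n →
      ‖Matrix.toEuclideanCLM (𝕜 := ℂ) K‖ ≤ (2 : ℝ) ^ b →
      (∀ z : σ → ℂ, (∀ j, ‖z j‖ ≤ 2) → MvPolynomial.eval z (1 + Matrix.diagonal (fun i => MvPolynomial.X (κ i)) * K.map (fun a : ℂ => (MvPolynomial.C a : MvPolynomial σ ℂ))).det ≠ 0) →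
      ∃ R' ≤ q ^ b * R, ∃ (K' : Matrix (Fin R') (Fin R') ℂ) (κ' : Fin R' → σ),
        ‖Matrix.toEuclideanCLM (𝕜 := ℂ) K'‖ ≤ 1 ∧
        (1 + Matrix.diagonal (fun i => MvPolynomial.X (κ i)) * K.map (fun a : ℂ => (MvPolynomial.C a : MvPolynomial σ ℂ))).det =
          (1 + Matrix.diagonal (fun i => MvPolynomial.X (κ' i)) * K'.map (fun a : ℂ => (MvPolynomial.C a : MvPolynomial σ ℂ))).det := by
  induction b with
  | zero =>
    intro R σ _ K κ _hRQ _hσ _hdeg hK _hz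
    exact ⟨R, by simp, K, κ, by simpa using hK, rfl⟩
  | succ b ih =>
    intro R σ _ K κ hRQ hσ hdeg hK hz
    have hM : (1 : ℝ) ≤ 2 ^ b := one_le_pow₀ (by norm_num)
    have hK2 : ‖Matrix.toEuclideanCLM (𝕜 := ℂ) K‖ ≤ 2 * 2 ^ b := by
      rw [pow_succ] at hK
      linarith
    -- the current size is in the domain: `R ≤ q ^ (b+1) · R ≤ Q`
    have hR : R ≤ Q :=
      le_trans (Nat.le_mul_of_pos_left R (Nat.pos_of_ne_zero (pow_ne_zero _ (by omega)))) hRQ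
    obtain ⟨R₁, hR₁, K₁, κ₁, hK₁, h₁⟩ := hc R (2 ^ b) K κ hR hσ hdeg hM hK2 hz
    -- the invariant for the induction hypothesis: `q ^ b · R₁ ≤ q ^ (b+1) · R ≤ Q`
    have hR₁Q : q ^ b * R₁ ≤ Q :=
      calc q ^ b * R₁ ≤ q ^ b * (q * R) := Nat.mul_le_mul_left _ hR₁
        _ = q ^ (b + 1) * R := by rw [pow_succ, mul_assoc]
        _ ≤ Q := hRQ
    have hdeg₁ : (1 + Matrix.diagonal (fun i => MvPolynomial.X (κ₁ i)) * K₁.map (fun a : ℂ => (MvPolynomial.C a : MvPolynomial σ ℂ))).det.totalDegree ≤ n := by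
      rw [← h₁]
      exact hdeg
    have hz₁ : (∀ z : σ → ℂ, (∀ j, ‖z j‖ ≤ 2) → MvPolynomial.eval z (1 + Matrix.diagonal (fun i => MvPolynomial.X (κ₁ i)) * K₁.map (fun a : ℂ => (MvPolynomial.C a : MvPolynomial σ ℂ))).det ≠ 0) := by
      intro z hz'
      rw [← h₁]
      exact hz z hz'
    obtain ⟨R', hR', K', κ', hK', h'⟩ := ih R₁ K₁ κ₁ hR₁Q hσ hdeg₁ hK₁ hz₁
    refine ⟨R', ?_, K', κ', hK', h₁.trans h'⟩
    calc R' ≤ q ^ b * R₁ := hR'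
      _ ≤ q ^ b * (q * R) := Nat.mul_le_mul_left _ hR₁
      _ = q ^ (b + 1) * R := by rw [pow_succ, mul_assoc]

/-- Monotonicity record: the rev-2…7 halving stub (all `M`, no domain) implies the rev-8 derived
form `Sig.stub_normHalvingDom` (drop the domain hypothesis). -/
theorem normHalvingDom_of_normHalving (h : Sig.stub_normHalving) : Sig.stub_normHalvingDom := by
  obtain ⟨c, hc⟩ := h
  exact ⟨c, fun n R M σ _ K κ _ hσ hdeg hM hK hz => hc n R M K κ hσ hdeg hM hK hz⟩

/-- The rev-8 glue in `Sig` form: NH₁ and the (registered, provable) rescaling implication give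
`Sig.stub_normHalvingDom`. -/
theorem normHalvingDom_of_one (hresc : Sig.stub_normHalvingOne → Sig.stub_normHalvingDom)
    (h1 : Sig.stub_normHalvingOne) : Sig.stub_normHalvingDom :=
  hresc h1

/-! ## §5 Proved glue 3: the size arithmetic -/

/-- The exponent arithmetic of the composition: with `L = 2ℓ + 2`, `B = (L + d) ^ d` (budget bits and
log-size after the budget step) and per-halving factor `2 ^ ((B + L + c) ^ c)`, the final size
`(2 ^ ((B + L + c) ^ c)) ^ B · R₁`, `R₁ ≤ 2 ^ B`, is `≤ 2 ^ ((ℓ + d') ^ d')` for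
`d' = 3d + 4c + 2dc + 4`. -/
theorem exponent_bound₂ (c d ℓ R₁ : ℕ) (hR : R₁ ≤ 2 ^ ((2 * ℓ + 2 + d) ^ d)) :
    (2 ^ (((2 * ℓ + 2 + d) ^ d + (2 * ℓ + 2) + c) ^ c)) ^ ((2 * ℓ + 2 + d) ^ d) * R₁ ≤
      2 ^ ((ℓ + (3 * d + 4 * c + 2 * (d * c) + 4)) ^ (3 * d + 4 * c + 2 * (d * c) + 4)) := by
  -- abbreviations
  generalize hB : (2 * ℓ + 2 + d) ^ d = B at *
  generalize hX : (B + (2 * ℓ + 2) + c) ^ c = X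
  generalize hE : 3 * d + 4 * c + 2 * (d * c) + 4 = E
  have h1 : (2 ^ X) ^ B * R₁ ≤ 2 ^ (X * B + B) := by
    rw [pow_add, ← pow_mul]
    exact Nat.mul_le_mul_left _ hR
  refine h1.trans (Nat.pow_le_pow_right two_pos ?_)
  -- the exponent: `X * B + B ≤ (ℓ + E) ^ E` via `v := ℓ + 2 + d + c ≥ 2`
  obtain ⟨v, hv⟩ : ∃ v : ℕ, v = ℓ + 2 + d + c := ⟨_, rfl⟩
  have hv2 : 2 ≤ v := by omega
  have h2v : 1 ≤ 2 * v := by omega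
  have hBle : B ≤ (2 * v) ^ d := by
    rw [← hB]; exact Nat.pow_le_pow_left (by omega) _
  have hsum : B + (2 * ℓ + 2) + c ≤ (2 * v) ^ (d + 2) := by
    have ha : (2 * v) ^ d ≤ (2 * v) ^ (d + 1) := Nat.pow_le_pow_right h2v (by omega)
    have hb : 2 * v ≤ (2 * v) ^ (d + 1) := by
      calc 2 * v = (2 * v) ^ 1 := (pow_one _).symm
        _ ≤ (2 * v) ^ (d + 1) := Nat.pow_le_pow_right h2v (by omega)
    calc B + (2 * ℓ + 2) + c ≤ (2 * v) ^ d + 2 * v := by omega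
      _ ≤ (2 * v) ^ (d + 1) + (2 * v) ^ (d + 1) := Nat.add_le_add ha hb
      _ = 2 * (2 * v) ^ (d + 1) := (two_mul _).symm
      _ ≤ (2 * v) * (2 * v) ^ (d + 1) := Nat.mul_le_mul_right _ (by omega)
      _ = (2 * v) ^ (d + 2) := by rw [← pow_succ']
  have hXle : X ≤ (2 * v) ^ ((d + 2) * c) := by
    rw [← hX, pow_mul]; exact Nat.pow_le_pow_left hsum _
  have h3 : X * B + B ≤ (2 * v) ^ (d + (d + 2) * c + 1) := by
    have hX1 : X + 1 ≤ 2 * (2 * v) ^ ((d + 2) * c) := by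
      have : 1 ≤ (2 * v) ^ ((d + 2) * c) := Nat.one_le_pow _ _ (by omega)
      omega
    calc X * B + B = B * (X + 1) := by ring
      _ ≤ (2 * v) ^ d * (2 * (2 * v) ^ ((d + 2) * c)) := Nat.mul_le_mul hBle hX1
      _ = 2 * (2 * v) ^ (d + (d + 2) * c) := by rw [pow_add]; ring
      _ ≤ (2 * v) * (2 * v) ^ (d + (d + 2) * c) := Nat.mul_le_mul_right _ (by omega)
      _ = (2 * v) ^ (d + (d + 2) * c + 1) := by rw [← pow_succ']
  have h4 : (2 * v) ^ (d + (d + 2) * c + 1) ≤ (v * v) ^ (d + (d + 2) * c + 1) :=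
    Nat.pow_le_pow_left (Nat.mul_le_mul_right v hv2) _
  have h5 : (v * v) ^ (d + (d + 2) * c + 1) = v ^ (2 * (d + (d + 2) * c + 1)) := by
    rw [pow_mul, pow_two]
  have hE1 : 2 * (d + (d + 2) * c + 1) ≤ E := by
    rw [← hE]; nlinarith [Nat.zero_le d, Nat.zero_le c]
  have hE2 : v ≤ ℓ + E := by
    rw [← hE, hv]; nlinarith [Nat.zero_le d, Nat.zero_le c]
  have hE3 : 1 ≤ ℓ + E := by omega
  calc X * B + B ≤ (2 * v) ^ (d + (d + 2) * c + 1) := h3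
    _ ≤ (v * v) ^ (d + (d + 2) * c + 1) := h4
    _ = v ^ (2 * (d + (d + 2) * c + 1)) := h5
    _ ≤ (ℓ + E) ^ (2 * (d + (d + 2) * c + 1)) := Nat.pow_le_pow_left hE2 _
    _ ≤ (ℓ + E) ^ E := Nat.pow_le_pow_right hE3 hE1

/-- The domain arithmetic of the rev-8 composition: `B` halvings at factor `2 ^ ((B + L + c) ^ c)`
starting from size `R₁ ≤ 2 ^ B` stay inside the domain `2 ^ ((B + L + c + 2) ^ (c + 2))` of NH₁
(`B · u^c + B ≤ (u + 2)^(c + 2)` for `u = B + L + c ≥ B`). -/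
theorem domain_bound (c B L R₁ : ℕ) (hR : R₁ ≤ 2 ^ B) :
    (2 ^ ((B + L + c) ^ c)) ^ B * R₁ ≤ 2 ^ ((B + L + c + 2) ^ (c + 2)) := by
  generalize hu : B + L + c = u
  have hBu : B ≤ u := by omega
  have h1 : (2 ^ (u ^ c)) ^ B * R₁ ≤ 2 ^ (u ^ c * B + B) := by
    rw [pow_add, ← pow_mul]
    exact Nat.mul_le_mul_left _ hR
  refine h1.trans (Nat.pow_le_pow_right two_pos ?_)
  rcases Nat.eq_zero_or_pos u with h0 | hpos
  · have hB0 : B = 0 := by omega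
    simp [hB0]
  · have h2 : u ^ c * B ≤ u ^ (c + 1) := by
      rw [pow_succ]; exact Nat.mul_le_mul_left _ hBu
    have h3 : B ≤ u ^ (c + 1) :=
      hBu.trans (calc u = u ^ 1 := (pow_one u).symm
        _ ≤ u ^ (c + 1) := Nat.pow_le_pow_right hpos (by omega))
    calc u ^ c * B + B ≤ u ^ (c + 1) + u ^ (c + 1) := Nat.add_le_add h2 h3
      _ = 2 * u ^ (c + 1) := (two_mul _).symm
      _ ≤ (u + 2) * u ^ (c + 1) := Nat.mul_le_mul_right _ (by omega)
      _ ≤ (u + 2) * (u + 2) ^ (c + 1) := Nat.mul_le_mul_left _ (Nat.pow_le_pow_left (by omega) _)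
      _ = (u + 2) ^ (c + 2) := (pow_succ' _ _).symm

/-! ## §6 The kernel-checked composition -/

/-- **Assembly of the line (rev 8).** `stub_balancedBudget → stub_normHalvingDom → PriceOfContractivity`:
Sylvester normal form (`R ≤ N·m ≤ 2 ^ L`, `L = 2 log₂(m+N) + 2`), balanced budget
(`R₁ ≤ 2 ^ B`, `‖K₁‖ ≤ 2 ^ B`, `B = (L + d) ^ d`), `B` halvings at factor `2 ^ ((B + L + c) ^ c)`
each (the halving stub at `n = 2 ^ (B + L)`, which bounds both `#σ` and the degree, on its domain
`R ≤ 2 ^ ((B + L + c + 2) ^ (c + 2))`, which the iteration never leaves: `domain_bound`), and the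
arithmetic `exponent_bound₂`. The conclusion is the route decl
`ContractivityPrice.PriceOfContractivity` by name. -/
theorem PriceOfContractivity_of :
    Sig.stub_balancedBudget → Sig.stub_normHalvingDom → PriceOfContractivity := by
  rintro ⟨d, hd⟩ ⟨c, hc⟩
  refine ⟨3 * d + 4 * c + 2 * (d * c) + 4, ?_⟩
  intro N m σ _ p hσ hrep hzero
  -- `p(0) ≠ 0` (zero-freeness at the centre)
  have hp0 : MvPolynomial.eval 0 p ≠ 0 :=
    hzero 0 (fun j => by simp only [Pi.zero_apply, norm_zero]; norm_num)
  -- Sylvester normal form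
  obtain ⟨R, hR, K₀, κ, hnf⟩ := normalForm_of_hasDetRepr hrep hp0
  -- the pencil inherits zero-freeness on the closed radius-2 polydisc
  have hz₀ : (∀ z : σ → ℂ, (∀ j, ‖z j‖ ≤ 2) → MvPolynomial.eval z (1 + Matrix.diagonal (fun i => MvPolynomial.X (κ i)) * K₀.map (fun a : ℂ => (MvPolynomial.C a : MvPolynomial σ ℂ))).det ≠ 0) := by
    intro z hz h
    exact hzero z hz (by rw [hnf, map_mul, h, mul_zero])
  -- bit length of the size: `R ≤ N·m ≤ (m+N)² ≤ 2 ^ L`, `L = 2 log₂(m+N) + 2`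
  have hlog : m + N < 2 ^ (Nat.log 2 (m + N) + 1) := Nat.lt_pow_succ_log_self one_lt_two _
  have hRL : R ≤ 2 ^ (2 * Nat.log 2 (m + N) + 2) := by
    calc R ≤ Fintype.card σ * m := hR
      _ ≤ (m + N) * (m + N) :=
          Nat.mul_le_mul (hσ.trans (Nat.le_add_left N m)) (Nat.le_add_right m N)
      _ ≤ 2 ^ (Nat.log 2 (m + N) + 1) * 2 ^ (Nat.log 2 (m + N) + 1) := Nat.mul_le_mul hlog.le hlog.le
      _ = 2 ^ (2 * Nat.log 2 (m + N) + 2) := by rw [← pow_add]; ring_nf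
  -- balanced budget
  obtain ⟨R₁, hR₁, K₁, κ₁, hK₁, hdet₁⟩ := hd (2 * Nat.log 2 (m + N) + 2) R K₀ κ hRL hz₀
  have hz₁ : (∀ z : σ → ℂ, (∀ j, ‖z j‖ ≤ 2) → MvPolynomial.eval z (1 + Matrix.diagonal (fun i => MvPolynomial.X (κ₁ i)) * K₁.map (fun a : ℂ => (MvPolynomial.C a : MvPolynomial σ ℂ))).det ≠ 0) := by
    intro z hz
    rw [← hdet₁]
    exact hz₀ z hz
  -- the complexity bound `n = 2 ^ (B + L)` for the halving stub
  generalize hL : 2 * Nat.log 2 (m + N) + 2 = L at *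
  generalize hB : (L + d) ^ d = B at *
  have hcard : Fintype.card σ ≤ 2 ^ (B + L) := by
    calc Fintype.card σ ≤ N := hσ
      _ ≤ m + N := Nat.le_add_left N m
      _ ≤ 2 ^ (Nat.log 2 (m + N) + 1) := hlog.le
      _ ≤ 2 ^ (B + L) := Nat.pow_le_pow_right two_pos (by omega)
  have hdeg : (1 + Matrix.diagonal (fun i => MvPolynomial.X (κ₁ i)) * K₁.map (fun a : ℂ => (MvPolynomial.C a : MvPolynomial σ ℂ))).det.totalDegree ≤ 2 ^ (B + L) :=
    (totalDegree_pencil_det_le K₁ κ₁).trans (hR₁.trans (Nat.pow_le_pow_right two_pos (by omega)))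
  -- the iteration stays in the domain of the halving stub
  have hdom : (2 ^ ((Nat.log 2 (2 ^ (B + L)) + c) ^ c)) ^ B * R₁ ≤
      2 ^ ((Nat.log 2 (2 ^ (B + L)) + c + 2) ^ (c + 2)) := by
    rw [Nat.log_pow one_lt_two]
    exact domain_bound c B L R₁ hR₁
  -- `B` halvings down to a contraction
  obtain ⟨R', hR', K', κ', hK', hdet'⟩ :=
    priceInBudget_of_normHalvingDom (q := 2 ^ ((Nat.log 2 (2 ^ (B + L)) + c) ^ c))
      (Q := 2 ^ ((Nat.log 2 (2 ^ (B + L)) + c + 2) ^ (c + 2))) (n := 2 ^ (B + L))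
      Nat.one_le_two_pow (fun R M σ _ K κ => hc (2 ^ (B + L)) R M K κ) B R₁ K₁ κ₁ hdom hcard hdeg
      hK₁ hz₁
  refine ⟨R', ?_, K', κ', hK', hnf.trans (by rw [hdet₁, hdet'])⟩
  rw [Nat.log_pow one_lt_two] at hR'
  subst hL hB
  exact hR'.trans (exponent_bound₂ c d (Nat.log 2 (m + N)) R₁ hR₁)

/-- **The skeleton**: `ContractivityPrice.PriceOfContractivity` BY NAME, modulo exactly the two
registered composing stubs `stub_stableLifting` (♦) and `stub_normHalvingOne` (NH₁), glued through the
registered, provable rescaling stub `stub_normHalvingRescale` (rev 8: every other theorem of this file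
is proved or cited from the tree; `stub_balancedBudget` is derived in §2c from ♦ and the LANDED
cycle-mean bound). -/
theorem PriceOfContractivity_proof : PriceOfContractivity :=
  PriceOfContractivity_of stub_balancedBudget (stub_normHalvingRescale stub_normHalvingOne)

end Summit.ValiantsHypothesis.ValiantsHypothesis.Cruxes.PriceOfContractivity.Birth
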